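import Mathlib
import HarnessLib
import HarnessLib.Audit
import Summits.AtomisticToContinuum.Statement
import Literature.Analysis.FluidPDE.HardSphereCollisionRecord
import Summits.AtomisticToContinuum.HydrodynamicLimit.Theorems.ImplosionDichotomyHsEosLowDensity
import HarnessLib.Audit.Status.Attr

/-!
Route: TwoClocks

DORMANT since 2026-08-24T16:47:25Z (reconciler: no traction for 6.9 d (last activity item-evidence-added at 2026-08-17T18:24:17Z); parked, not closed — `ledger route dormant route-AtomisticToContinuum-TwoClocks --off` to reactivate) — unstaffed, not closed; items shared with open routes are served there. `ledger route dormant <id> --off` reactivates.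

# Route TwoClocks — Two clocks — finite kinetic-window large deviations at fixed density from
(almost-)invariant Gibbs data, docked into Yau's entropy Gronwall by a deciding theorem

It suffices to show X_TC ∧ (P) ∧ (M) — the kinetic clock X_TC = (A) ∧ (B″) ∧ (C) ∧ (D) ∧ (E″), the
PDE side (P) and the macroscopic clock (M), seven cruxes in all and nothing else (crux-only deciding
theorem since rev 6) — realising card kinetic-windows-inside-yau ("two clocks": kinetic theory is
asked only
about finitely many collision times, Yau's Liouville-invariant relative entropy carries macroscopic
time); the D-0027 §2.1-conforming successor of
route-AtomisticToContinuum-KineticWindows (retired 2026-08-15 `not-a-thesis`). Collisional side: rev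
3 (2026-08-15) replaced the paper-refuted CAPPED collisional
ex-crux stmt-14441 (dense-blob cage-virial witness) by the activity-CLAMPED crux over the landed
collision records (`HardSphereFlow.collisionSum`); rev 10
(2026-08-16, this repair) replaces that crux, stmt-13733 EquilibriumClampedCollisionalWindowLD —
REFUTED IN LEAN (`…Theorems.TwoClocksEquilibriumClampedCollisionalWindowLD_refuted`,
frozen line-lattice Newton-cradle relay: the MOMENTUM-only activity clamp lets a relay sphere pass
while its ENERGY payload V_p²/2 is unbounded; class
refuted-misstated) — by the repaired statement C′ with the TRANSFER-activity clamp, as pre-committed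
in KILL CRITERIA ("misstated ⇒ repair, new item").
(A) EquilibriumFastWindowLD: under the GLOBAL canonical Gibbs law of N+1 deterministic hard spheres
on 𝕋³ at FIXED small reduced density σ³
(flow-invariant reference; σ₀ universal), every continuous one-body functional F(x,v) of quadratic
growth that is orthogonal under the Maxwellian
to the collision invariants 1, v, |v|² has window pressure Λ_τ(β) = limsup_N (N+1)⁻¹ log E exp(β Σ_i
w⁻¹∫₀^w F(x_i(r),v_i(r)) dr) ≤ ε for ONE
suitable window w = τ(N+1)^(-1/3) (≍ τσ² mean free times: finite kinetic time) at each fixed small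
β. (B″) ClampedTransferWindowLD (= C′): the same for
the window-averaged COLLISIONAL momentum and energy transfer tested against a smooth φ, Σ_coll
ω_iω_j[φ(x_i)−φ(x_j)]Δq_i summed over the collision records
of the window, CLAMPED pair-symmetrically by the window TRANSFER activity of the two partners (ω_i =
1{a_i ≤ V}, a_i = (σ/τ)·Σ_(coll of i)(‖Δv_i‖ +
|Δ‖v_i‖²|/2) = momentum + energy impulse; Gibbs mean 3θ₀(Z−1) ≈ 2πσ³θ₀ for the momentum part and
O(√θ₀ + |u₀|) times that for the energy part; ≍ θ₀/δ′ in a cage of gap δ′; → ∞ along a Newton-cradle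
relay) — so that ALL
FOUR rows are pathwise bounded, |w⁻¹X| ≤ ½‖∇φ‖V(N+1), caged cores and energy relays contribute
nothing, and no explicit-control witness can bite (gain
≤ |β|‖∇φ‖V/2 per sphere against ≥ 3 log τ pinning cost) — minus the explicit equation-of-state
projection onto the conserved one-body fields (coefficients
θ₀σ³Z′(σ³), (1/3)(Z(σ³)−1), θ₀(Z(σ³)−1): the linear response of p_ex = ρθ(Z−1) and of p_ex·u,
unchanged); quantifiers ∃V₀ ∀V≥V₀ ∃β₀ ∀|β|≤β₀ ∀ε ∃τ₀ ∀τ≥τ₀;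
typed VERBATIM as the landed `Theorems.ClampedTransferCoin.ClampedTransferWindowLD` (`Iff.rfl`),
which the sorry-free conditional compositions
`clampedTransferWindowLD_of_LD` (coarse-coin line) and `clampedTransferWindowLD_of_radialVirialLD`
(radial-virial line) already conclude. (C) LocalGibbsTransfer:
(A) ⟹ KineticWindowLDUniform, the same window LD from smooth LOCAL Gibbs data, uniformly over dilute
profiles (activity-ratio guard σ³·sup a ≤ η₀∫a; the docking
node, kept as the typed intermediate target KineticWindowLDUniform, claimable directly) — "LD
currency makes the almost-invariant local reference free".
(D) EnergyCurrentTails (shared stmt-9235) and (E″) TransferActivityTails: a-priori L¹ control, under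
the TRUE evolution, of the cubic velocity moments and of the
TRANSFER-activity tail (N+1)⁻¹Σ_i a_i 1{a_i > V} (removes the truncation of the heat flux and prices
the clamp of (B″): every dropped collision has a clamped
partner and impulse(record) = impulse(twin record) by momentum AND energy conservation, so the
pathwise remainder is ≤ ‖∇φ‖ × the transfer-activity tail;
(E″) follows from the old momentum tails stmt-13734 and its energy twin — landed
`ClampedCurrentsDockTransferTails.stub_transferActivityTails`). (P)
DiluteSelfConsistency (shared stmt-3091): the classical hs-Euler solution tied to the data stays
dilute, ρ_tσ³ < η, up to T. (M) TransferEntropyClock (crux 11):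
the macroscopic clock run to the Statement — KineticWindowLDUniform → (B″) → (E″) → (D) → (P) →
HydrodynamicLimit, i.e. Yau's relative-entropy Gronwall fed by the
window-LD inputs, the statics UniformLocalGibbsConcentration / HsEosLowDensity and the entropy
inequality EntropyToHydro (all three PROVED) being lemmas inside its proof.
Lean: `EquilibriumFastWindowLD ∧ ClampedTransferWindowLD ∧ LocalGibbsTransfer ∧ EnergyCurrentTails ∧
TransferActivityTails ∧ DiluteSelfConsistency ∧ TransferEntropyClock`

## Assembly
Pure logic (glue.lean, sorry-free; crux-only since rev 6, re-docked rev 10): `closes (h₂ :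
EquilibriumFastWindowLD) (h₅ : LocalGibbsTransfer) (h₃ : ClampedTransferWindowLD) (h₆ :
EnergyCurrentTails) (h₇ : TransferActivityTails) (hS : DiluteSelfConsistency) (hC :
TransferEntropyClock) : _root_.HydrodynamicLimit := hC (h₅ h₂) h₃ h₇ h₆ hS` — the seven binders are
exactly the seven cruxes; no support, target or assembly item is a hypothesis. The two kinetic
cruxes (A) = crux 2 and (C) = crux 5 (literally EquilibriumFastWindowLD → KineticWindowLDUniform)
produce the docking node KineticWindowLDUniform INSIDE the proof (`h₅ h₂`); the node stays filed as
a typed intermediate target (rank 4), claimable directly — a direct proof of it closes cruxes 2 and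
5 at once, and if crux 5 dies tenure re-promotes the node to crux rank 2 and re-docks `closes` on it
(one edit). The assembly frame item ("docking node ∧ (B″) ∧ (D) ∧ (E″) ∧ statics ∧ (P) → Statement",
rank 1) is the gate-required Assembly item — a weakening of crux TransferEntropyClock (`fun hK h₃ h₆
h₇ _ _ hS => hC hK h₃ h₇ h₆ hS`, checked), not a binder. History: rev 3 dropped the capped
collisional ex-crux stmt-14441 + its cap-pricing twin stmt-14444 + the old dock stmt-14447; revs 5–9
made `closes` crux-only with the clock crux ClampedEntropyClock (stmt-15145) carrying the docking;
rev 10 (route-repair after the Lean refutation of stmt-13733): stmt-13733 → ClampedTransferWindowLD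
(C′, transfer-activity clamp), stmt-13734 CollisionActivityTails → TransferActivityTails (same
activity), stmt-15145 ClampedEntropyClock → TransferEntropyClock and Assembly restated (both had the
refuted decl as an antecedent and had been closed VACUOUSLY — `clampedEntropyClock_proof`,
`clampedWindowDock_proof` — for the wrong reason), the equally vacuous dock support stmt-13735
ClampedWindowDock DROPPED (redundant with crux 11 now that EntropyToHydro /
UniformLocalGibbsConcentration / HsEosLowDensity are proved); the refuted decl stays indexed as
negative knowledge.

Rationale: WHY THIS LINE. The one positive-density Euler derivation (OllaVaradhanYau1993 Thm 2.1; Yau1991;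
KipnisLandim1999 Ch. 6) uses its weak noise in exactly one
place, the one-block/local-ergodic step (OVY Thm 3.10, §4 (A)–(E)); because relative entropy is
Liouville-invariant, the entropy inequality for
the PATH law transfers typicality from the dynamics RESTARTED at the explicit local Gibbs law ψ_s to
the true law at cost h(s)N, so a LINEAR
Gronwall consumes exactly one dynamical input: an exponential-moment (large-deviation) estimate for
window averages of the fast currents under
Gibbs-started deterministic dynamics over a macroscopically vanishing window — finitely many mean
free times, the time regime of Lanford1975 /
BGSSAnnals2023 (Thm 3: LD up to Lanford's time) / BGSSCPAM2023 (Thm 1.1: equilibrium covariances for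
arbitrarily long finite kinetic times) /
BodineauEtAl2024 / LeBihan2022, here to be run at FIXED small σ³ (recollisions bounded per mean free
time by 3-D transience, not killed by ε → 0)
and in LD rather than L² strength. Imported area: dynamical cluster/cumulant expansions and pruning
of collision trees (kinetic theory,
probability) nested inside the relative entropy method; plus large-deviation locality (corridor/cell
arguments) for (C). What this line does that the two open routes sharing the window-LD node do not:
FluxGibbsianityLdDrude attacks the node by convex duality + Gibbsian rigidity of infinite-volume
tilted states, OneFlightGossipEngine by one-flight hyperbolicity + gossip averaging; this route
attacks it by finite-window expansions around an invariant reference and isolates the equilibrium ⇒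
local-equilibrium passage as its own crux; relative to the retired KineticWindows it adds the
deciding theorem (crux-only since rev 6), a TYPED clamped collisional crux over the landed collision
records with the explicit EOS projection — a pair-symmetric per-particle TRANSFER-ACTIVITY CLAMP
(momentum + energy impulse) priced under the true law by TransferActivityTails, reached after two
recorded refutations (the capped form stmt-14441: dense-blob cage virial; the momentum-clamped form
stmt-13733: Newton-cradle energy relay, Lean) — and η₀-uniform local statements with
DiluteSelfConsistency an explicit crux.

RANKED CRUXES. #0 RelEntropyVanishing (target) — Yau's entropy form of the limit (shared typed
target stmt-0766): along the classical hs-Euler solution tied to the data, some local Gibbs law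
(a_t,u_t,θ_t) concentrates its three fields exponentially around (ρ,ρu,E)(t) and the specific
relative entropy of the true law w.r.t. it → 0; the informative intermediate of crux 11
TransferEntropyClock (Yau proves exactly this; EntropyToHydro, proved, finishes). (why it might
fail: entropy production ≥ cN before the first shock for some smooth data closes every entropy
route; OVY need noise and a bounded-gradient kinetic energy; implosions leave the dilute regime.)
[Yau1991, OllaVaradhanYau1993, Varadhan1993EntropyMethods]
#2 EquilibriumFastWindowLD (crux) — KW AT GLOBAL EQUILIBRIUM, FIXED SMALL DENSITY, GENERAL FAST
ONE-BODY FUNCTIONALS (card crux 1 kinetic part × crux 2(b)). ∃ universal σ₀ ∀ constants a₀, θ₀ > 0,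
u₀ ∀σ ∈ (0,σ₀) ∀ hard-sphere flow families ∀ continuous F of quadratic growth orthogonal under
M_(1,u₀,θ₀) to 1, v_j, |v|²: ∃β₀ ∀|β| ≤ β₀ ∀ε ∃τ ∃N₀ ∀N ≥ N₀: ∫ exp(β Σ_i w⁻¹∫₀^w F((Φ_N.flow r
z)_i) dr) dG_N ≤ exp(ε(N+1)), w = τ(N+1)^(-1/3), G_N the flow-invariant canonical Gibbs law
(constant profiles). The fixed-density wall in its friendliest form: upper bound only,
time-averaged, finite window, invariant explicit reference, no rate claimed. [difficulty:
open-problem] (why it might fail: beyond Lanford's time no expansion controls scale-N exponential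
moments even at equilibrium (BGSSAnnals2023 Thm 3 short-time; BGSSCPAM2023 covariance-level,
Boltzmann–Grad); at fixed σ³ recollision classes must be bounded, not killed; a hidden slow one-body
mode keeps Λ_τ ≥ cβ².) [BGSSAnnals2023, BGSSCPAM2023, BodineauEtAl2024, LeBihan2022,
arXiv:2205.04110, OllaVaradhanYau1993, Spohn1991]
#3 ClampedTransferWindowLD (crux; rev-10 repair of ex-crux stmt-13733
EquilibriumClampedCollisionalWindowLD, REFUTED IN LEAN 2026-08-16 by
`Theorems.TwoClocksEquilibriumClampedCollisionalWindowLD_refuted` — frozen line-lattice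
Newton-cradle relay: with the MOMENTUM-only activity clamp a relay sphere has act = 2στ^(-1/4) ≤ V
while each transfer moves the energy V_p²/2 = τ^(3/2)/2 one slot up ∇(−φ), so w⁻¹Xᵉ ≥ cστ^(1/2)(N+1)
at pinning cost O((N+1)(log τ + log(1/σ))); energy conjunct false for every β > 0 and V; momentum
rows not hit; class refuted-misstated, crux workfile
`Cruxes/EquilibriumClampedCollisionalWindowLD/Disproof.lean`) — CLAMPED COLLISIONAL-TRANSFER WINDOW
LD AT GLOBAL EQUILIBRIUM, EOS-PROJECTED, TRANSFER-ACTIVITY CLAMP (= C′, endorsed by the disprover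
and the five line leads; typed over `HardSphereFlow.collisionSum`). Frame of crux 2; ∃V₀ ∀V≥V₀ ∃β₀
∀|β|≤β₀ ∀ε ∃τ₀ ∀τ≥τ₀ ∃N₀ ∀N≥N₀. Transfer activity a_i := (σ/τ)Σ_(coll of i in (0,w])(‖Δv_i‖ +
|Δ‖v_i‖²|/2), clamp ω_i := 1{a_i ≤ V}, clamped pair-symmetric transfers X^k, X^e over the collision
records and the EOS projections A^k_w, A^e_w exactly as before (item docstring). Claim: ∫ exp(β(w⁻¹X
− w⁻¹A)) dG_N ≤ exp(ε(N+1)) (three momentum components, energy). Now ALL FOUR rows are pathwise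
bounded, |w⁻¹X| ≤ ½‖∇φ‖_∞V(N+1) (a retained particle carries momentum AND energy impulse ≤ Vτ/σ, and
ε_N·τ/σ = w): blobs, cages and cradle relays drop out pair-symmetrically, an explicit-control
witness gains ≤ |β|‖∇φ‖V/2 per sphere against ≥ 3 log τ pinning cost, so what is left is a genuine
large-deviation statement about TYPICAL Gibbs dynamics over τσ² → ∞ mean free times. Typed VERBATIM
as the landed `Theorems.ClampedTransferCoin.ClampedTransferWindowLD` (`Iff.rfl`, Sketch.lean rc 0):
the sorry-free conditional compositions `clampedTransferWindowLD_of_LD : ActivityOverflowLD →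
CoinBudgetLD → CompensatorDefectLD → RateWindowLD → C′` (coarse-coin line, CompositionC1/C3) and
`clampedTransferWindowLD_of_radialVirialLD` (radial-virial line, RadialVirialAssembly) conclude it;
their open cores are audited down to two missing dynamical facts — (F1) N-uniform window LD / Cesàro
decay of clamped collisional currents of deterministic hard spheres beyond Lanford's time, (F2) the
N-uniform tagged-particle transfer-activity LLN lim_τ limsup_N G_N(act₁ > V) = 0 — and the statics
are exact at linear order (means vanish by 𝕋³-translation invariance and ∫∂φ = 0; density /
temperature / velocity responses = the EOS coefficients given the virial theorem for the true
hsCompressibility). [deps: HsEosLowDensity, TransferActivityTails] [difficulty: open-problem] (why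
it might fail: as crux 2; the clamp-deficit static residual makes C′ contain the tagged-particle
activity LLN (F2); a sub-entropy-cost collective mechanism among unclamped particles (recollision
rings, rate/partner-selection bias) could keep Λ_τ ≥ c|β|.) [OllaVaradhanYau1993, Spohn1991,
BGSSAnnals2023, BGSSCPAM2023, Serre2021, SalsburgWood1962]
#4 KineticWindowLDUniform (target since rev 6: the intermediate statement the kinetic cruxes reach;
typed, vetted, claimable) — THE DOCKING NODE consumed by crux 11 and PRODUCED inside `closes` as
crux 5 applied to crux 2 (h₅ h₂): window LD for fast one-body functionals from LOCAL Gibbs data,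
uniform over dilute profiles (activity-ratio guard σ³·sup a ≤ η₀∫a); the η₀-uniform strengthening of
the profile-wise stmt-9530 / ex-stmt-3654. Logically the conjunction of cruxes 2 and 5 (converse
glue in the item evidence), hence not a crux under the cap (and not a support: open-problem-grade,
not a prover obligation); a direct proof closes cruxes 2 and 5 at once, and it is re-badged crux
rank 2 if crux 5 dies. [difficulty: open-problem] [OllaVaradhanYau1993, KipnisLandim1999,
BGSSCPAM2023, BGSSAnnals2023]
#5 LocalGibbsTransfer (crux) — LD CURRENCY MAKES LOCAL GIBBS DATA FREE (card crux 2(a); a binder of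
`closes` since rev 5): EquilibriumFastWindowLD ⟹ KineticWindowLDUniform — the window LD for fast
one-body functionals transfers from global Gibbs data (all constant parameters) to smooth local
Gibbs data, uniformly over dilute profiles (σ³·sup a ≤ η₀ ∫a). Intended proof: cells δ with
corridors κ, w ≪ κ ≪ δ; finite influence speed over w → 0 decouples cells up to LD-negligible
events; Markov property of the hard-core Gibbs law given corridor contents + ensemble equivalence
(free in LD); per-cell Rényi comparison with frozen parameters; δ → 0 after N → ∞. [deps:
EquilibriumFastWindowLD, KineticWindowLDUniform] [difficulty: L] (why it might fail: factorising
scale-N exponential moments over cells needs true conditional independence (Hölder across δ⁻³ cells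
multiplies β by δ⁻³); an influence front crossing corridors at sub-extensive LD cost couples cells;
cells are boxes with in/outflow, not tori, so (A) must be re-run locally.) [KipnisLandim1999,
OllaVaradhanYau1993, BGSSCPAM2023, Spohn1991, Kifer1990]
#6 EnergyCurrentTails (crux) — UNIFORM INTEGRABILITY OF THE CUBIC ENERGY CURRENT BEFORE THE FIRST
SHOCK (shared typed crux stmt-9235): for continuous profiles ∃ σ₀ ∀ σ ∈ (0,σ₀) ∀ classical hs-Euler
solutions on [0,T) ∀ flow families, if the local Gibbs fields converge at t = 0 then ∀ t < T ∀ ε > 0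
∃ M ∃ N₀ ∀ N ≥ N₀ ∀ s ∈ [0,t]: E[(N+1)⁻¹ Σ_i |v_i(s)|³ 1(|v_i(s)| > M)] ≤ ε. Cuts the kinetic heat
flux to a quadratic-growth truncation; the irreducible HighMomentumCutoff instance of every Gronwall
route. [difficulty: open-problem] (why it might fail: the deterministic dynamics could focus energy
~N^(2/3) on O(1) particles with entropy-invisible probability (f_s ≤ e^(κN)·Gibbs only excludes
Gibbs-cost e^(−κ′N) events; cubic tails have sub-extensive LD cost); no maximum principle for
hard-sphere energy cascades is known.) [NachtergaeleYau2003, OllaVaradhanYau1993, Spohn1991,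
Literature.Barriers.AtomisticToContinuum.HighMomentumCutoffBarrierNarrow]
#7 TransferActivityTails (crux; rev-10 restate of stmt-13734 CollisionActivityTails with the SAME
transfer activity as crux 3) — A-PRIORI L¹ TAILS OF THE WINDOW TRANSFER ACTIVITY UNDER THE TRUE
EVOLUTION (prices the clamp of crux 3). For continuous profiles ∃σ₀ ∀σ ∈ (0,σ₀) ∀ classical hs-Euler
solutions on [0,T) tied to the data by the t = 0 LLN, ∀ flows, ∀ t < T ∃V₀ ∀V ≥ V₀ ∀ε ∃τ₀ ∀τ ≥ τ₀
∃N₀ ∀N ≥ N₀ ∀s ∈ [0,t]: E_(λ₀)[(N+1)⁻¹ Σ_i a_i(s) 1{a_i(s) > V}] ≤ ε, a_i(s) := (σ/τ)Σ_(coll of i in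
(s,s+w])(‖Δv_i‖ + |Δ‖v_i‖²|/2) along the true trajectory. Pathwise |w⁻¹(X_true − X_clamped)| ≤
‖∇φ‖_∞ Σ_i a_i 1{a_i > V} for the momentum AND the energy row (every dropped record has a clamped
partner, |φ(x_i)−φ(x_j)| ≤ ‖∇φ‖ε_N at contact, and impulse(record) = impulse(twin) by momentum and
energy conservation): this IS the clock's remainder. Byte-identical with the landed
`Theorems.ClampedCurrentsDockTransferTails.TransferActivityTails` (OneFlightGossipEngine dock line)
and implied by the old momentum tails stmt-13734 ∧ its energy twin CollisionEnergyActivityTails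
(landed `stub_transferActivityTails`, (a+b)1{a+b>V} ≤ 2a1{a>V/2} + 2b1{b>V/2}). The content: the
TRUE pre-shock law develops neither long-lived caging of a positive fraction nor a cubic
energy-impulse tail in mean (not obtainable from entropy). [difficulty: open-problem] (why it might
fail: no extensive a-priori bound on collision impulses — momentum or energy — under a
non-equilibrium hard-sphere law is known (Serre2021 Thm 1.1 / Serre2024 grow in N); the energy
impulse is a cubic velocity tail with sub-extensive LD cost; focusing could cage a positive fraction
pre-shock.) [Serre2021, Serre2024, OllaVaradhanYau1993, BuragoFerlegerKononenko1998,
CercignaniIllnerPulvirenti1994]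
#9 DiluteSelfConsistency (crux since rev 6; shared stmt-3091, crux rank 3 of route
ImplosionLoophole) — ∀η > 0 ∀ continuous profiles ∃σ₀ ∀σ < σ₀ ∀ classical hs-Euler solutions on
[0,T) tied to the data by the t = 0 LLN: ρ_t(x)σ³ < η for all t < T. The PDE-side input every
dilute-input route needs; conjecture-grade, hence a crux and a binder of `closes`, never a support
(D-0027). [difficulty: open-problem] (why it might fail: σ-uniform density control at the FIRST
singularity of 3-D compressible hs-Euler for ALL smooth data is beyond Sideris1985/LukSpeck2024
(open sets of data); MRRS-type smooth implosions (MerleEtAl2022), if the hs-EOS admits them, push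
ρ_tσ³ past every η before T* — refuter g48-1 flag.) [Sideris1985, LukSpeck2024, MerleEtAl2022,
Spohn1991, OllaVaradhanYau1993]
#11 TransferEntropyClock (crux; rev-10 restate of stmt-15145 ClampedEntropyClock, which had the
refuted stmt-13733 as antecedent and was closed VACUOUSLY by `clampedEntropyClock_proof` — ledger
progress only; ranked last: it renders after every decl it composes) — THE MACROSCOPIC CLOCK RUN TO
THE STATEMENT: KineticWindowLDUniform → ClampedTransferWindowLD → TransferActivityTails →
EnergyCurrentTails → DiluteSelfConsistency → HydrodynamicLimit, i.e. Yau's relative-entropy Gronwall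
for deterministic hard spheres at fixed small σ³ fed ONLY by the finite-window LD inputs, the two
a-priori tails and dilute self-consistency; the statics UniformLocalGibbsConcentration (PROVED),
HsEosLowDensity (PROVED) and the entropy inequality EntropyToHydro (PROVED, via RelEntropyVanishing)
are lemmas INSIDE its proof, so `closes` has crux binders only; it implies by weakening the assembly
frame (rank 1, restated alongside). Weaker than the Statement (`fun _ _ _ _ _ => h`), hence never
refutable short of ¬HydrodynamicLimit: its risk is PROVABILITY FROM ITS ANTECEDENTS AS BLACK BOXES.
What the crux lines on 15145 / 14680 / 9133 established (crux workfiles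
`Cruxes/ClampedEntropyClock/NOTES.md`, `Cruxes/ClampedCurrentsDock/Lines/IdeatorTwoSketch.md`,
HEART-STATUS.md): (a) UNIFORMITY — a clock along the time-dependent reference family ψ_s cannot net
POINTWISE-threshold inputs (β₀, τ₀ chosen per reference instance): the Hölder/Rényi change of
reference costs e^(c(δ)(N+1)) at fixed rate, the net must refine with ε and min_j β₀(ψ_(s_j)) has no
positive lower bound from black-box thresholds; the heart wants FAMILY-UNIFORM typings
(`KineticCurrentsWindowLDFamily`, `LocalClampedTransferWindowLDFamily`: thresholds uniform along a
jointly continuous compact family of profiles, ∀s innermost); (b) LOCALISATION of C′ (global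
equilibrium) to local Gibbs data at LD scale is a separate transfer step (corridor/cell method of
crux 5), not an in-clock argument (gap #3); (c) the energy row consumes the kinetic node for BOUNDED
truncated heat fluxes in the ∀β shape (R1 `KineticWindowLDUniformBounded`); (d) given family-uniform
inputs the ONE-WINDOW ENTROPY LEDGER (`OneWindowLedger`, 14680 lead c2) is PROVED sorry-free
(landing in nine `ClampedCurrentsDockHeart*` files) and eleven TwoClocks clock helpers are landed
(DiscreteEntropyGronwall, TimeZeroReference, WindowPerturbationLe, Hellinger/klDiv lemmas,
EntropyVariablesProduction, CollisionJumpExponent, …). Hence the foreseen split of this crux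
(TWO-LAYER PLAN): localisation-to-families + family-uniform kinetic node + the landed heart.
[difficulty: L given family-uniform inputs; open-problem as an implication from the pointwise nodes]
(why it might fail: black-box pointwise thresholds of KineticWindowLDUniform / C′ do not net
uniformly along the Euler reference family (UNIFORMITY finding); localising C′ to local Gibbs
families at LD scale is unproved; the energy row needs the ∀β bounded kinetic node; OVY needed noise
exactly here.) [Yau1991, OllaVaradhanYau1993, KipnisLandim1999, Varadhan1993EntropyMethods,
Spohn1991]
#9 UniformLocalGibbsConcentration (support, PROVED 2026-08-16
`uniformLocalGibbsConcentration_proof`) — η₀-UNIFORM EXPONENTIAL LLN FOR CANONICAL LOCAL GIBBS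
STATES (consumable strengthening of stmt-0767): for dilute profiles (σ³·sup a ≤ η₀∫a) the local
Gibbs laws are probability measures whose three empirical fields concentrate exponentially around a
continuous ρ₀ > 0; static cluster expansion; a lemma inside crux 11. [difficulty: M] [Ruelle1969,
LebowitzPenrose1964, KipnisLandim1999]
#9 EquilibriumShearWindowLD (support) — THE CHEAPEST TYPED RUNG (ex-stmt-3656 with the universal
σ₀): crux 2 for u₀ = 0 and the kinetic shear stress F(x,v) = φ(x)v¹v² (automatically orthogonal to
1, v, |v|²). Λ_(2τ) ≤ Λ_τ by Hölder + invariance. Its negation closes the route. [difficulty: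
open-problem] [BGSSCPAM2023, BodineauEtAl2024, LeBihan2022, BodineauGallagherSaintRaymondInvent2016]
#9 HsEosLowDensity (support, PROVED 2026-08-16) — hard-sphere equation of state at low density
(shared stmt-0768): hsExcessFreeEnergy real-analytic near 0 with F(0) = 0, F′(0) = 2π/3 and the
canonical limit existing; makes Z, Z′ in crux 3 the true virial quantities. [Ruelle1969,
LebowitzPenrose1964]
#9 EntropyToHydro (support, PROVED 2026-08-16 `heatBathForgetting_assembly_proof`) —
RelEntropyVanishing → the conjunct (shared stmt-0769, verbatim): entropy inequality μ(A) ≤ (log 2 +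
H(μ|λ))/log(1 + 1/λ(A)) with λ(A) ≤ C e^(−(N+1)/C) and H = o(N); `_root_.HydrodynamicLimit` unfolds
to the Literature constant; the last step inside crux 11. [difficulty: provable-now] [Yau1991,
OllaVaradhanYau1993, KipnisLandim1999]



TWO-LAYER PLAN. Foreseen glued splits (k ≤ 3, depth 1; nothing filed in this repair edit — the
family-uniform node texts are being finalised on the OneFlightGossipEngine side, and a split needs
free slots: 14/15 items after rev 10). TransferEntropyClock ⇐ ClampedTransferLocalisation (C′ along
compact families of constants → `LocalClampedTransferWindowLDFamily`: local Gibbs data, x-frozen EOS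
coefficients η(x) = ρ₀(x)σ³, centring c-numbers, thresholds uniform along the family; ONE item to be
shared with OneFlightGossipEngine's dock 14680 and HydroLimitInBand 9133, ex-S5b there) →
KineticWindowLDFamily (family-uniform sharpening of the node KineticWindowLDUniform incl. the ∀β
bounded-functional clause R1; shared with 14662/9133's `KineticCurrentsWindowLDFamily` where the
texts agree) → WindowEntropyLedger (Yau's one-window entropy ledger along the explicit reference
family a_s = ρ_s·Rf(σ³ρ_s) fed by those inputs + TransferActivityTails + EnergyCurrentTails + DSC: =
14680's `OneWindowLedger`, PROVED by lead 14680-c2, + the landed TwoClocks glue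
`stub_discreteEntropyGronwall` p100251, `stub_timeZeroReference` p101191,
`ClampedCurrentsDockReduction.stub_reduction` p97835, typed composition
`Cruxes/ClampedEntropyClock/Lines/IdeatorTwoSketch_restated.lean`) → TransferEntropyClock; tenure
files it with `route edit --split TransferEntropyClock --into …` as soon as the family texts are
landed items (dedup by signature makes them shared), dropping EquilibriumShearWindowLD if a slot is
needed. EquilibriumFastWindowLD ⇐ ShortWindowTreeLD (scale-N exponential moments of collision-tree
functionals over ONE window of ≤ Lanford length at fixed σ³, BGSSAnnals2023 pruning) →
WindowConcatenation (invariance of G_N + conditioning on the past, LeBihan2022) →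
EquilibriumFastWindowLD. ClampedTransferWindowLD ⇐ its registered crux lines
(coarse-coin-entropy-chain: ActivityOverflowLD, CoinBudgetLD, CompensatorDefectLD, RateWindowLD;
radial-virial-polarization: isotropic upper/lower tails, traceless virial, thermal transfer) —
stubs, not items. LocalGibbsTransfer ⇐ CorridorLocality (finite speed of influence at every
exponential scale over vanishing windows) → CellwiseEquivalence (ensemble equivalence + Rényi
comparison per cell) → LocalGibbsTransfer.

KILL CRITERIA. ¬EquilibriumShearWindowLD or ¬EquilibriumFastWindowLD (a fast kinetic functional
whose window pressure stays ≥ c > 0 for every window at some fixed small β under GLOBAL Gibbs data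
at arbitrarily small σ: a hidden slow stress mode of the deterministic gas) closes the route
outright (`close --reason refuted:EquilibriumFastWindowLD`) and moots KineticCurrentsWindowLD-based
plans elsewhere. SETTLED NEGATIVE EDGES: (rev 3) the capped, unclamped collisional LD
(ex-stmt-14441) is false by the dense-blob witness — never re-file it, capped, spatially cut off or
one-particle-weighted; (rev 10) the MOMENTUM-activity-clamped collisional LD (ex-stmt-13733) is
false in Lean by the Newton-cradle energy relay — never clamp by an activity that does not dominate
the energy impulse of the retained records. ¬ClampedTransferWindowLD by a surviving conserved
component (residual statically correlated with a density/energy/velocity field at order σ³, e.g. the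
lab-frame δu-response of the clamp deficit at u₀ ≠ 0) = misstated: repair the coefficients / the
frame of the energy impulse (c2's u₀-frame clamp) as a new item; by a sub-entropy-cost gain
mechanism of TYPICAL Gibbs dynamics that survives the transfer clamp (rate or partner-selection
bias, recollision rings) = substantive: the collisional programme of this route is dead — retire
(`close --reason refuted:ClampedTransferWindowLD`). ¬LocalGibbsTransfer (locality fails at LD
scale): pivot — the node KineticWindowLDUniform (target) is re-badged crux rank 2, `closes` is
re-docked on it (binders hK h₃ h₆ h₇ hS hC), cruxes 2 and 5 are dropped and the engine must run
under local Gibbs data directly. TransferEntropyClock cannot be refuted short of ¬HydrodynamicLimit;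
it dies as a CUT if its split children die: entropy production ≥ cN under the TRUE law although
every family-uniform window-LD and tail input holds (¬WindowEntropyLedger, substantive) closes this
and every relative-entropy route; ¬ClampedTransferLocalisation (C′ true globally but not along local
families) sends the collisional input to be filed LOCALLY (the family node as crux 3, C′ demoted to
support) by one `route edit`. ¬EnergyCurrentTails or ¬TransferActivityTails (energy focusing /
spontaneous caging of a positive fraction before the first shock) closes this AND every
relative-entropy route with true currents. ¬DiluteSelfConsistency (implosion tracking wins) forces
the operator's packing-guarded conjunct on every dilute-input route; this route then re-targets by
`route edit`. KineticCurrentsWindowLDUniform + ClampedCurrentsDock proved in OneFlightGossipEngine,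
or KineticFluxLdDecay + KineticWindowGronwall in FluxGibbsianityLdDrude, moot cruxes 2, 5 and the
node but not cruxes 3, 6, 7, 9, 11.

NOT DECOMPOSED YET. The ENGINE of crux 2 (fixed-σ³ pruning/conditioning expansion; alternatives
E2/E3 of card §Mechanism 6) is a proof strategy: crux lines, never rival families. The
family-uniform local form of C′ and the family-uniform kinetic node are the clock's foreseen
children (TWO-LAYER PLAN) and are NOT filed in this repair edit: their texts must coincide
byte-for-byte with the OneFlightGossipEngine / HydroLimitInBand typings against which the one-window
ledger was proved, and those are landing now. The heat-flux truncation, the static identification of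
the EOS projection (exact at linear order, audited by three seats), the pathwise remainder bound
|w⁻¹(X_true−X)| ≤ ‖∇φ‖Σ a_i1{a_i>V} (landed: momentum impulse
`EntropyClockDock.abs_collisionSum_unclamped_le` in TwoClocksClampedWindowDockClampRemainder,
transfer impulse in OneFlightGossipEngineClampedCurrentsDockClampRemainder), the activity inversion
ρ ↦ a (landed `TwoClocksClampedWindowDockActivityInversion`): glue below crux 11 (`--supports`
lemmas). No third layer will be filed.

CHEAPEST FALSIFIER. (i) CRADLE / BLOB AUDIT (done for C′ by the disprover and leads -0/c4: the
Newton-cradle relay, dense blobs, loose cages, hot/cold spots, boosts, corridors are all clamped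
away or entropy-dominated because β₀ is chosen after V, φ, σ — re-run any NEW explicit-control
family against the TRANSFER clamp first; a family with gain/cost → ∞ at bounded transfer activity
refutes crux 3 substantively). (ii) FINITE-N INTEGRABILITY AUDIT (free, holds): every row ≤
½‖∇φ‖V(N+1) pathwise after w⁻¹. (iii) STATIC COEFFICIENT CHECK (second virial order): the clamped
residual must have vanishing static covariance with Σχ(x_i), Σχ(x_i)|v_i−u₀|² and Σχ(x_i)(v_i−u₀) at
order σ³ as τ → ∞ (audited exact at linear order GIVEN the tagged-activity LLN; the u₀ ≠ 0 lab-frame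
δu-response of the clamp deficit is the one place a mismatch could hide) — a mismatch = misstated.
(iv) CALIBRATION: Λ_τ is τ-independent for the ideal gas (nothing claimed at σ = 0), ≍ β²/(ν₀τσ²)
for the linear-Boltzmann caricature. (v) MD (kit): packing 0.05–0.2, N = 10³–10⁵, equilibrium start:
window pressures of shear and clamped collisional stress must decrease in τ with no N-growing
plateau; the transfer activity a_i must concentrate (tagged-particle LLN (F2)).

NUMBERS. w_N = τ(N+1)^(-1/3) ≍ τ·πσ²√θ₀ mean free times; ε_N/w = σ/τ. E_G a_i = 3θ₀(Z(σ³)−1) ≈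
2πσ³θ₀ for the momentum part of the activity (virial theorem), times O(√θ₀ + |u₀|) for the energy
part; fcc cage at gap δ′: a ≍ θ₀/δ′ (SalsburgWood1962), cost 3log(1/δ′)+3log(1/σ)+6.9 per particle;
cradle relay at τ = t⁴: momentum activity ≍ 1/(l²t) → 0 but transfer activity ≍ t²/l² → ∞
(Disproof.lean). T* ≈ 0.2 mean free times (BGSSAnnals2023 Thm 3). EOS at leading order (Z = 1 +
(2π/3)η + O(η²), η = σ³): ∂_ρp_ex = (2π/3)σ³θ₀, ∂_e p_ex = (4π/9)σ³, p_ex⁰ = (2π/3)σ³θ₀. Expected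
Λ_τ(β) ≈ cβ²/(ν₀τσ²). Items after rev 10: 14 active (7 cruxes = the 7 binders of `closes`, 2 targets
(RelEntropyVanishing, the node KineticWindowLDUniform), 1 assembly (non-binder), 4 supports:
HsEosLowDensity / EntropyToHydro / UniformLocalGibbsConcentration PROVED, EquilibriumShearWindowLD
open = the expendable one); one free slot.

DEFINITION REQUESTS. None: `Literature.Analysis.FluidPDE.HardSphereCollisionRecord` (landed;
`HardSphereFlow.collisionSum`, record fields fst/snd/fstPos/sndPos/preVel/postVel) serves cruxes 3
and 7; the repaired pair is also available in named form in
`Theorems/OneFlightGossipEngineEquilibriumClampedCollisionalWindowLDDefs.lean` (namespace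
`ClampedTransferCoin`: impulse / runAct / flagG / payload / Xrow / Arow,
`clampedTransferWindowLD_iff`); crux 11 is a composition of existing decls.

Novelty: Searches (2026-08-15, this seat): `lit search --source arxiv "dynamical large deviations hard sphere
gas Boltzmann equation"` (3: arXiv:2008.10403,
arXiv:2205.04110, arXiv:2409.02805); `lit search --source arxiv "Bodineau Gallagher Saint-Raymond
Simonella long time correlations hard spheres"`
(1: arXiv:2012.03813, Thm 1.1 + Remark READ: covariance → linearised Boltzmann for any fixed kinetic
time, o((log|log ε|)^(1/4)), Boltzmann–Grad);
arXiv:2008.10403 p. 9 Thm 3 READ (LD upper/lower bounds up to T*, grand canonical, Boltzmann–Grad);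
`lit frontier AtomisticToContinuum --since 2022`
(30 rows: arXiv:2602.04407 DHM survey, doi:10.1007/s10955-026-03570-w moderate deviations for a
binary collision model, arXiv:2310.13338; none on
fixed-density window LD); `lit search --hybrid` ×2 (textbooks only); `lit galaxy search … --star
all` ×5 (0 relevant rows; OpenAlex/arXiv remote
budget exhausted mid-session — recorded, not claimed); `ledger negatives` (3 HydrodynamicLimit
negatives read); the two open routes sharing the node
(FluxGibbsianityLdDrude, OneFlightGossipEngine) and the retired KineticWindows file read in full;
inherited from the card/gen-1: OVY pp. 3, 15–18,
LeBihan2022 intro, KipnisLandim1999 Ch. 6 pp. 126–134, Spohn1991 Ch. 3 notes (Sinai 1988),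
DemasiPresutti1991 pp. 74, 126–128.
Nearest prior art found: OllaVaradhanYau1993 Thm 3.10/§4 and KipnisLandim1999 Ch. 6 §1 (one-block
via entropy inequality w.r.t. the restarted
reference process + Feynman–Kac/ergodic input — the "k  [refs: 10.1007/s10955-026-03570-w, 2008.10403, 2205.04110, 2409.02805, 2012.03813, 2602.04407, 2310.13338, doi:10.1007/s10955-026-03570-w, LeBihan2022, KipnisLandim1999, Spohn1991, DemasiPresutti1991, OllaVaradhanYau1993, BGSSAnnals2023, BGSSCPAM2023, BodineauEtAl2024]

Barriers (technique_class: relative-entropy large-deviations kinetic-windows): - technique_class: relative-entropy large-deviations kinetic-windows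
- Literature.Barriers.AtomisticToContinuum.BoltzmannHypothesisBarrierNarrow: evaded in form — no
stationary state of the infinite-volume dynamics is classified and no flux-level closure on such
states is invoked; the one-block input is a finite-N, finite-window exponential-moment bound under
an explicit invariant Gibbs law (the barrier's scope caveat (b): a finite-volume N-uniform
substitute evades it). Its ideal-gas kernel (h_C: rest-frame heat current) is respected: crux 2 is
false for free flight (Λ_τ ≡ Λ_(0+)) and is claimed only for 0 < σ < σ₀ with τ after σ.
- Literature.Barriers.AtomisticToContinuum.BoltzmannHypothesisBarrier: superseded by the Narrow
block; same answer.
- Literature.Barriers.AtomisticToContinuum.MacroErgodicityBarrier: same technique token, not met in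
substance — no sector condition, no generator inversion, no macroscopic-time fluctuation–dissipation
decomposition; macro-ergodicity is replaced by a finite-window LD input (the barrier text itself
records macro-ergodicity as sufficient, not necessary).
- Literature.Barriers.AtomisticToContinuum.HighMomentumCutoffBarrierNarrow: APPLIES and is NOT
evaded — isolated as the typed a-priori cruxes EnergyCurrentTails (cubic UI in mean, pre-shock) and
CollisionTransferTails; inside every LD functional only quadratic-growth observables appear (the
narrow kernel `setLIntegral_exp_cubic_eq_top` is exactly why the heat flux is truncated and the co

History (route lifecycle, newest last):
- 2026-08-15T20:20:39Z · rev 3: restated EquilibriumCollisionalWindowLD (stmt-AtomisticToContinuum-14441), CollisionTransferTails (stmt-AtomisticToContinuum-14444), WindowDock (stmt-AtomisticToContinuum-14447), Assembly (stmt-AtomisticToContinuum-14448) — route-repair (cone gen 2 → substantive): cone is clean (gate deps n_unproved=0; the 4 'un (planner-rrepair-AtomisticToContinuum-TwoClocks-14734c96-g2-0)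
- 2026-08-15T20:20:39Z · rev 3: dropped stmt-AtomisticToContinuum-13435 — route-repair (cone gen 2 → substantive): cone is clean (gate deps n_unproved=0; the 4 'unproved cone facts' are the summit's own conjunct constants via the oper (planner-rrepair-AtomisticToContinuum-TwoClocks-14734c96-g2-0)
- 2026-08-15T21:18:55Z · rev 4: restated Assembly (stmt-AtomisticToContinuum-13736) — route-repair (ground-failed, rev 3 → 4): restated Assembly (stmt-AtomisticToContinuum-13736, ground.trivial 'intros; aesop') — the rev-3 Assembly was literally (planner-rground-AtomisticToContinuum-TwoClocks-14734c96-0)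
- 2026-08-16T19:57:52Z · BROKEN — EquilibriumClampedCollisionalWindowLD (stmt-AtomisticToContinuum-13733, crux) refuted by Summit.AtomisticToContinuum.HydrodynamicLimit.Theorems.OneFlightGossipEngineEquilibriumClampedCollisionalWindowLD_refuted @ 8061795fe1a3 (refuter-cdisprove-stmt-AtomisticToContinuum-13733-0)
- 2026-08-16T20:17:18Z · rev 10: restated EquilibriumClampedCollisionalWindowLD (stmt-AtomisticToContinuum-13733 refuted), CollisionActivityTails (stmt-AtomisticToContinuum-13734), ClampedEntropyClock (stmt-AtomisticToContinuum-15145 proved), Assembly (stmt-AtomisticToContinuum-13805 proved) — route-repair rev 10 (unit rfix-…-TwoClocks-14734c9 (planner-rfix-AtomisticToContinuum-TwoClocks-14734c96-0)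
- 2026-08-16T20:17:18Z · rev 10: dropped ClampedWindowDock — route-repair rev 10 (unit rfix-…-TwoClocks-14734c96; BROKEN by the Lean refutation of crux 3 stmt-13733 EquilibriumClampedCollisionalWindowLD — Theorems.TwoCloc (planner-rfix-AtomisticToContinuum-TwoClocks-14734c96-0)
- 2026-08-16T20:17:18Z · REPAIRED (restate EquilibriumClampedCollisionalWindowLD, CollisionActivityTails, ClampedEntropyClock, Assembly; drop ClampedWindow) — back to open: route-repair rev 10 (unit rfix-…-TwoClocks-14734c96; BROKEN by the Lean refutation of crux 3 stmt-13733 EquilibriumClampedCollisionalWindowLD — Theorems.TwoCloc (planner-rfix-AtomisticToContinuum-TwoClocks-14734c96-0)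
- 2026-08-24T16:47:25Z · DORMANT — reconciler: no traction for 6.9 d (last activity item-evidence-added at 2026-08-17T18:24:17Z); parked, not closed — `ledger route dormant route-AtomisticToConti (operator:999:943836)

sub-problem: HydrodynamicLimit · status: dormant · opened planner-plancard-AtomisticToContinuum-Hydrody-53d9f76d-g2-0 2026-08-15T19:08:34Z · rev 10 · ledger route-AtomisticToContinuum-TwoClocks
GENERATED by the gate from the ledger (D-0016/17). Provers cite these decls: `theorem foo : Summit.AtomisticToContinuum.HydrodynamicLimit.Theses.TwoClocks.<Decl> := …` in Summits/AtomisticToContinuum/HydrodynamicLimit/Theorems/<Name>.lean.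
-/

namespace Summit.AtomisticToContinuum.HydrodynamicLimit.Theses.TwoClocks

open scoped BigOperators Topology Manifold Classical MeasureTheory ProbabilityTheory Matrix InnerProductSpace ComplexConjugate ContinuousMap
open Filter Set Function TopologicalSpace MeasureTheory

attribute [summit_statement] _root_.HydrodynamicLimit

/-- item stmt-AtomisticToContinuum-0766 · target · rank 0 · open · by planner
why it might fail: entropy production ≥ cN before the first shock for some smooth data would close every entropy route; OVY prove it only with noise and a bounded-gradient kinetic energy; implosion-type solutions leave the dilute regime (card implosion-loophole).
sources: Yau1991, OllaVaradhanYau1993, Varadhan1993EntropyMethods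
[target] X_RE: for all continuous profiles ∃ σ₀ ∀ σ<σ₀ ∀ classical hs-Euler solutions on [0,T) ∀
flows: the initial local Gibbs laws are probability measures and, if their fields converge at t=0,
then ∀ t<T ∃ activity profile a_t such that the reference local Gibbs law (a_t, u_t, θ_t) is a
probability measure whose empirical density/momentum/energy fields concentrate exponentially (≤ C
e^{-(N+1)/C}) around (ρ,ρu,E)(t), and klDiv(lawAt Φ_N (localGibbs a₀u₀θ₀) t ‖ localGibbs a_t u_t
θ_t)/(N+1) → 0. Yau1991; OllaVaradhanYau1993 Thm 1.1 (with noise). -/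
@[route_item "route-AtomisticToContinuum-TwoClocks", crux]
def RelEntropyVanishing : Prop :=
  ∀ (a₀ θ₀ : Literature.MathematicalPhysics.KineticTheory.T3 → ℝ) (u₀ : Literature.MathematicalPhysics.KineticTheory.T3 → Literature.MathematicalPhysics.KineticTheory.V3), Continuous a₀ → Continuous θ₀ → Continuous u₀ → (∀ x, 0 < a₀ x) → (∀ x, 0 < θ₀ x) → ∃ σ₀ : ℝ, 0 < σ₀ ∧ ∀ σ : ℝ, 0 < σ → σ < σ₀ → ∀ (T : ℝ) (ρ θ : ℝ → Literature.MathematicalPhysics.KineticTheory.T3 → ℝ) (u : ℝ → Literature.MathematicalPhysics.KineticTheory.T3 → Literature.MathematicalPhysics.KineticTheory.V3), Literature.MathematicalPhysics.KineticTheory.IsHardSphereEulerSolution σ T ρ u θ → ∀ Φ : (N : ℕ) → Literature.Analysis.FluidPDE.HardSphereFlow (Literature.Analysis.FluidPDE.Torus.geometry (Fin 3)) (Literature.MathematicalPhysics.KineticTheory.hsDiameter σ N) (N + 1), (∀ N, MeasureTheory.IsProbabilityMeasure (Literature.MathematicalPhysics.KineticTheory.localGibbsLaw σ a₀ u₀ θ₀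 N (Φ N))) ∧ (Literature.MathematicalPhysics.KineticTheory.TendstoHydroFieldsAt (fun N => Literature.MathematicalPhysics.KineticTheory.localGibbsLaw σ a₀ u₀ θ₀ N (Φ N)) Φ ρ u θ 0 → ∀ t ∈ Set.Ico 0 T, ∃ a : Literature.MathematicalPhysics.KineticTheory.T3 → ℝ, (∀ N, MeasureTheory.IsProbabilityMeasure (Literature.MathematicalPhysics.KineticTheory.localGibbsLaw σ a (u t) (θ t) N (Φ N))) ∧ (∀ χ : Literature.MathematicalPhysics.KineticTheory.T3 → ℝ, Continuous χ → ∀ δ : ℝ, 0 < δ → ∃ C : ℝ, 0 < C ∧ ∀ N : ℕ, Literature.MathematicalPhysics.KineticTheory.localGibbsLaw σ a (u t) (θ t) N (Φ N) {z | δ < |Literature.MathematicalPhysics.KineticTheory.empiricalDensityField z χ - ∫ x, χ x * ρ t x|} ≤ ENNReal.ofReal (C * Real.exp (-(C⁻¹ * (N + 1)))) ∧ Literature.MathematicalPhysics.KineticTheory.localGibbsLaw σ a (u t) (θ t) N (Φ N) {z | δ < ‖Literature.MathematicalPhysics.KineticTheory.empiricalMomentumField z χ - ∫ x, (χ x * ρ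 t x) • u t x‖} ≤ ENNReal.ofReal (C * Real.exp (-(C⁻¹ * (N + 1)))) ∧ Literature.MathematicalPhysics.KineticTheory.localGibbsLaw σ a (u t) (θ t) N (Φ N) {z | δ < |Literature.MathematicalPhysics.KineticTheory.empiricalEnergyField z χ - ∫ x, χ x * Literature.MathematicalPhysics.KineticTheory.totalEnergyDensity (ρ t x) (u t x) (θ t x)|} ≤ ENNReal.ofReal (C * Real.exp (-(C⁻¹ * (N + 1))))) ∧ Filter.Tendsto (fun N : ℕ => InformationTheory.klDiv ((Φ N).lawAt (Literature.MathematicalPhysics.KineticTheory.localGibbsLaw σ a₀ u₀ θ₀ N (Φ N)) t) (Literature.MathematicalPhysics.KineticTheory.localGibbsLaw σ a (u t) (θ t) N (Φ N)) / ((N : ENNReal) + 1)) Filter.atTop (nhds 0))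

/-- item stmt-AtomisticToContinuum-14440 · crux · rank 2 · open · by planner
why it might fail: beyond Lanford's time no expansion controls scale-N exponential moments even at equilibrium (BGSSAnnals2023 Thm 3 short-time; BGSSCPAM2023 covariance-level, Boltzmann–Grad); at fixed σ³ recollision classes must be bounded, not killed; a hidden slow one-body mode keeps Λ_τ ≥ cβ².
sources: BGSSAnnals2023, BGSSCPAM2023, BodineauEtAl2024, LeBihan2022, arXiv:2205.04110, OllaVaradhanYau1993
[crux] KW AT GLOBAL EQUILIBRIUM, FIXED SMALL DENSITY, GENERAL FAST ONE-BODY FUNCTIONALS (card crux 1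
kinetic part × crux 2(b)). There is a universal σ₀ > 0 such that for all constants a₀, θ₀ > 0, u₀ ∈
ℝ³, all 0 < σ < σ₀, every family of hard-sphere flows Φ_N (N+1 spheres of diameter σ(N+1)^(-1/3) on
𝕋³) and every continuous F : 𝕋³×ℝ³ → ℝ with |F(x,v)| ≤ C(1+|v|²), orthogonal under M_(1,u₀,θ₀) at
every x to 1, v_j, |v|²: ∃ β₀ > 0 ∀ |β| ≤ β₀ ∀ ε > 0 ∃ τ > 0 ∃ N₀ ∀ N ≥ N₀: ∫ exp(β Σ_i w⁻¹∫₀^w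
F((Φ_N.flow r z)_i) dr) dG_N ≤ exp(ε(N+1)), w = τ(N+1)^(-1/3), G_N = localGibbsLaw σ a₀ u₀ θ₀
(constant profiles; canonical Gibbs boosted by u₀, flow-invariant). Finite at every N for |β| <
1/(4Cθ₀). The fixed-density wall in its friendliest form: upper bound only, time-averaged, finite
window, invariant explicit reference, no rate claimed. [difficulty: open-problem] -/
@[route_item "route-AtomisticToContinuum-TwoClocks", crux]
def EquilibriumFastWindowLD : Prop :=
  ∃ σ₀ : ℝ, 0 < σ₀ ∧ ∀ (a₀ θ₀ : ℝ) (u₀ : Literature.MathematicalPhysics.KineticTheory.V3), 0 < a₀ → 0 < θ₀ → ∀ σ : ℝ, 0 < σ → σ < σ₀ → ∀ Φ : (N : ℕ) → Literature.Analysis.FluidPDE.HardSphereFlow (Literature.Analysis.FluidPDE.Torus.geometry (Fin 3)) (Literature.MathematicalPhysics.KineticTheory.hsDiameter σ N) (N + 1), ∀ F : Literature.MathematicalPhysics.KineticTheory.T3 × Literature.MathematicalPhysics.KineticTheory.V3 → ℝ, Continuous F → (∃ C : ℝ, ∀ y, |F y| ≤ C * (1 + ‖y.2‖ ^ 2)) →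 (∀ x, ∫ v, F (x, v) * Literature.Analysis.FluidPDE.localMaxwellian 1 θ₀ u₀ v = 0) → (∀ x (j : Fin 3), ∫ v, F (x, v) * v j * Literature.Analysis.FluidPDE.localMaxwellian 1 θ₀ u₀ v = 0) → (∀ x, ∫ v, F (x, v) * ‖v‖ ^ 2 * Literature.Analysis.FluidPDE.localMaxwellian 1 θ₀ u₀ v = 0) → ∃ β₀ : ℝ, 0 < β₀ ∧ ∀ β : ℝ, |β| ≤ β₀ → ∀ ε : ℝ, 0 < ε → ∃ τ : ℝ, 0 < τ ∧ ∃ N₀ : ℕ, ∀ N : ℕ, N₀ ≤ N → ∫⁻ z, ENNReal.ofReal (Real.exp (β * ∑ i : Fin (N + 1), (τ * ((N : ℝ) + 1) ^ (-(1 / 3 : ℝ)))⁻¹ * ∫ r in (0 : ℝ)..(τ * ((N : ℝ) + 1) ^ (-(1 / 3 : ℝ))), F (((Φ N).flow r z) i))) ∂(Literature.MathematicalPhysics.KineticTheory.localGibbsLaw σ (fun _ => a₀) (fun _ => u₀) (fun _ => θ₀) N (Φ N)) ≤ ENNReal.ofReal (Real.exp (ε * ((N : ℝ) + 1)))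

/-- item stmt-AtomisticToContinuum-16623 · crux · rank 3 · open · by planner
why it might fail: as crux 2 (no control of scale-N exponential moments beyond Lanford's time at fixed σ³); the clamp deficit makes C′ contain the tagged-particle transfer-activity LLN; a sub-entropy-cost collective bias of typical Gibbs dynamics (rates, partner selection, recollision rings) could keep Λ_τ ≥ c|β|.
sources: OllaVaradhanYau1993, Spohn1991, BGSSAnnals2023, BGSSCPAM2023, Serre2021, SalsburgWood1962
[crux] CLAMPED COLLISIONAL-TRANSFER WINDOW LD AT GLOBAL EQUILIBRIUM, EOS-PROJECTED,
TRANSFER-ACTIVITY CLAMP (C′ — rev-10 repair of ex-crux EquilibriumClampedCollisionalWindowLD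
stmt-AtomisticToContinuum-13733, refuted in Lean 2026-08-16 by
`Theorems.TwoClocksEquilibriumClampedCollisionalWindowLD_refuted`: frozen line-lattice Newton-cradle
relay against the ENERGY conjunct — the momentum-only activity clamp lets a relay sphere pass while
each transfer moves the energy V_p²/2 up ∇(−φ); class refuted-misstated; crux workfile
`Cruxes/EquilibriumClampedCollisionalWindowLD/Disproof.lean`). Frame of crux 2 (universal σ₀;
constants a₀,θ₀,u₀, canonical Gibbs G_N = localGibbsLaw with constant profiles; smooth φ);
quantifiers ∃V₀ ∀V≥V₀ ∃β₀ ∀|β|≤β₀ ∀ε ∃τ₀ ∀τ≥τ₀ ∃N₀ ∀N≥N₀; w = τ(N+1)^(-1/3); Z =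
hsCompressibility(σ³), Z′ its derivative. TRANSFER activity of particle i over the window: a_i :=
(σ/τ)·Σ_(collisions of i with times in (0,w]) (‖v_i⁺ − v_i⁻‖ + |‖v_i⁺‖² − ‖v_i⁻‖²|/2) (momentum +
energy impulse; Gibbs mean 3θ₀(Z−1) ≈ 2πσ³θ₀ for the momentum part, O(√θ₀+|u₀|) times that for the
energy part; ≍ θ₀/δ′ in a cage of gap δ′; → ∞ along a cradle relay); clamp ω_i := 1{a_i ≤ V}.
Momentum k: X^k : -/
@[route_item "route-AtomisticToContinuum-TwoClocks", crux]
def ClampedTransferWindowLD : Prop :=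
  ∃ σ₀ : ℝ, 0 < σ₀ ∧ ∀ (a₀ θ₀ : ℝ) (u₀ : Literature.MathematicalPhysics.KineticTheory.V3), 0 < a₀ → 0 < θ₀ → ∀ σ : ℝ, 0 < σ → σ < σ₀ → ∀ Φ : (N : ℕ) → Literature.Analysis.FluidPDE.HardSphereFlow (Literature.Analysis.FluidPDE.Torus.geometry (Fin 3)) (Literature.MathematicalPhysics.KineticTheory.hsDiameter σ N) (N + 1), ∀ φ : Literature.MathematicalPhysics.KineticTheory.T3 → ℝ, Literature.Analysis.FunctionSpaces.Torus.IsSmooth φ → ∃ V₀ : ℝ, 0 < V₀ ∧ ∀ V : ℝ, V₀ ≤ V → ∃ β₀ : ℝ, 0 < β₀ ∧ ∀ β : ℝ, |β| ≤ β₀ → ∀ ε : ℝ, 0 < ε → ∃ τ₀ : ℝ, 0 < τ₀ ∧ ∀ τ : ℝ, τ₀ ≤ τ → ∃ N₀ : ℕ, ∀ N : ℕ, N₀ ≤ N → (let w : ℝ := τ * ((N : ℝ) + 1) ^ (-(1 / 3 : ℝ)); let P := Literature.MathematicalPhysics.KineticTheory.localGibbsLaw σ (fun _ => a₀) (fun _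 => u₀) (fun _ => θ₀) N (Φ N); let Z : ℝ := Literature.MathematicalPhysics.KineticTheory.hsCompressibility (σ ^ 3); let Z' : ℝ := deriv Literature.MathematicalPhysics.KineticTheory.hsCompressibility (σ ^ 3); let act := fun (i : Fin (N + 1)) (z : Literature.Analysis.FluidPDE.Config (N + 1) (Fin 3) Literature.MathematicalPhysics.KineticTheory.T3) => σ / τ * (Φ N).collisionSum (Set.Ioc 0 w) (fun c => if c.fst = i then ‖c.postVel.1 - c.preVel.1‖ + |‖c.postVel.1‖ ^ 2 - ‖c.preVel.1‖ ^ 2| / 2 else 0) z; let ω := fun (i : Fin (N + 1)) (z : Literature.Analysis.FluidPDE.Config (N + 1) (Fin 3) Literature.MathematicalPhysics.KineticTheory.T3) => if act i z ≤ V then (1 : ℝ) else 0; let Xm := fun (k : Fin 3) (z : Literature.Analysis.FluidPDE.Config (N + 1) (Fin 3) Literature.MathematicalPhysics.KineticTheory.T3) => (Φ N).collisionSum (Set.Ioc 0 w) (fun c => ω c.fst z * ω c.snd z * ((φ c.fstPos - φ c.sndPos) * (c.postVel.1 k - c.preVel.1 k)) / 2) z; let Am := fun (k : Fin 3) (z :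 Literature.Analysis.FluidPDE.Config (N + 1) (Fin 3) Literature.MathematicalPhysics.KineticTheory.T3) => ∫ r in (0 : ℝ)..w, ∑ i, Literature.Analysis.FunctionSpaces.Torus.partialDeriv k φ ((Φ N).flow r z i).1 * (θ₀ * σ ^ 3 * Z' + (1 / 3) * (Z - 1) * ‖((Φ N).flow r z i).2 - u₀‖ ^ 2); let Xe := fun (z : Literature.Analysis.FluidPDE.Config (N + 1) (Fin 3) Literature.MathematicalPhysics.KineticTheory.T3) => (Φ N).collisionSum (Set.Ioc 0 w) (fun c => ω c.fst z * ω c.snd z * ((φ c.fstPos - φ c.sndPos) * ((‖c.postVel.1‖ ^ 2 - ‖c.preVel.1‖ ^ 2) / 2)) / 2) z; let Ae := fun (z : Literature.Analysis.FluidPDE.Config (N + 1) (Fin 3) Literature.MathematicalPhysics.KineticTheory.T3) => ∫ r in (0 : ℝ)..w, ∑ i, ((∑ l, u₀ l * Literature.Analysis.FunctionSpaces.Torus.partialDeriv l φ ((Φ N).flow r z i).1) * (θ₀ * σ ^ 3 * Z' + (1 / 3) * (Z - 1) * ‖((Φ N).flow r z i).2 - u₀‖ ^ 2) + θ₀ *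 (Z - 1) * (∑ l, Literature.Analysis.FunctionSpaces.Torus.partialDeriv l φ ((Φ N).flow r z i).1 * (((Φ N).flow r z i).2 - u₀) l)); (∀ k : Fin 3, ∫⁻ z, ENNReal.ofReal (Real.exp (β * (w⁻¹ * Xm k z - w⁻¹ * Am k z))) ∂P ≤ ENNReal.ofReal (Real.exp (ε * ((N : ℝ) + 1)))) ∧ ∫⁻ z, ENNReal.ofReal (Real.exp (β * (w⁻¹ * Xe z - w⁻¹ * Ae z))) ∂P ≤ ENNReal.ofReal (Real.exp (ε * ((N : ℝ) + 1))))

/-- item stmt-AtomisticToContinuum-14442 · target · rank 4 · open · by planner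
why it might fail: as crux 2 (no expansion controls scale-N exponential moments beyond Lanford's time at fixed σ³) plus crux 5 (LD locality); a profile-dependent packing threshold not captured by the activity ratio sup a/∫a would break the η₀-uniformity.
sources: OllaVaradhanYau1993, KipnisLandim1999, BGSSCPAM2023, BGSSAnnals2023
[crux] THE DOCKING NODE (what `closes` consumes on the kinetic side; delivered by crux 2 + crux 5,
claimable directly): window LD for fast one-body functionals from LOCAL Gibbs data, uniform over
dilute profiles — ∃ η₀ > 0 ∀ continuous a, θ₀ > 0, u₀ ∀ σ > 0 with σ³·sup_x a(x) ≤ η₀·∫a (packing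
guard through the activity ratio; at constant activity it reads σ³ ≤ η₀), ∀ flows, ∀ continuous F of
quadratic growth orthogonal at every x under M_(1,u₀(x),θ₀(x)) to 1, v_j, |v|²: ∃ β₀ ∀ |β| ≤ β₀ ∀ ε
∃ τ ∃ N₀ ∀ N ≥ N₀: ∫ exp(β Σ_i w⁻¹∫₀^w F((Φ_N.flow r z)_i) dr) dλ^N ≤ exp(ε(N+1)), λ^N =
localGibbsLaw σ a u₀ θ₀ N Φ_N. The η₀-uniform (consumable along an Euler evolution) strengthening of
the profile-wise stmt-9530 / ex-stmt-3654. [difficulty: open-problem] -/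
@[route_item "route-AtomisticToContinuum-TwoClocks", crux]
def KineticWindowLDUniform : Prop :=
  ∃ η₀ : ℝ, 0 < η₀ ∧ ∀ (a θ₀ : Literature.MathematicalPhysics.KineticTheory.T3 → ℝ) (u₀ : Literature.MathematicalPhysics.KineticTheory.T3 → Literature.MathematicalPhysics.KineticTheory.V3), Continuous a → Continuous θ₀ → Continuous u₀ → (∀ x, 0 < a x) → (∀ x, 0 < θ₀ x) → ∀ σ : ℝ, 0 < σ → σ ^ 3 * (⨆ x, a x) ≤ η₀ * ∫ x, a x → ∀ Φ : (N : ℕ) → Literature.Analysis.FluidPDE.HardSphereFlow (Literature.Analysis.FluidPDE.Torus.geometry (Fin 3)) (Literature.MathematicalPhysics.KineticTheory.hsDiameter σ N) (N + 1), ∀ F : Literature.MathematicalPhysics.KineticTheory.T3 × Literature.MathematicalPhysics.KineticTheory.V3 → ℝ, Continuous F → (∃ C : ℝ, ∀ y, |F y| ≤ C * (1 + ‖y.2‖ ^ 2)) → (∀ x, ∫ v, F (x, v) * Literature.Analysis.FluidPDE.localMaxwellian 1 (θ₀ x) (u₀ x) v = 0) → (∀ x (j : Fin 3), ∫ v, F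 (x, v) * v j * Literature.Analysis.FluidPDE.localMaxwellian 1 (θ₀ x) (u₀ x) v = 0) → (∀ x, ∫ v, F (x, v) * ‖v‖ ^ 2 * Literature.Analysis.FluidPDE.localMaxwellian 1 (θ₀ x) (u₀ x) v = 0) → ∃ β₀ : ℝ, 0 < β₀ ∧ ∀ β : ℝ, |β| ≤ β₀ → ∀ ε : ℝ, 0 < ε → ∃ τ : ℝ, 0 < τ ∧ ∃ N₀ : ℕ, ∀ N : ℕ, N₀ ≤ N → ∫⁻ z, ENNReal.ofReal (Real.exp (β * ∑ i : Fin (N + 1), (τ * ((N : ℝ) + 1) ^ (-(1 / 3 : ℝ)))⁻¹ * ∫ r in (0 : ℝ)..(τ * ((N : ℝ) + 1) ^ (-(1 / 3 : ℝ))), F (((Φ N).flow r z) i))) ∂(Literature.MathematicalPhysics.KineticTheory.localGibbsLaw σ a u₀ θ₀ N (Φ N)) ≤ ENNReal.ofReal (Real.exp (ε * ((N : ℝ) + 1)))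

/-- item stmt-AtomisticToContinuum-14443 · crux · rank 5 · open · by planner
why it might fail: factorising scale-N exponential moments over cells needs true conditional independence (Hölder across δ⁻³ cells multiplies β by δ⁻³); an influence front crossing corridors at sub-extensive LD cost couples cells; cells are boxes with in/outflow, not tori, so (A) must be re-run locally.
sources: KipnisLandim1999, OllaVaradhanYau1993, BGSSCPAM2023, Spohn1991, Kifer1990
[crux] LD CURRENCY MAKES LOCAL GIBBS DATA FREE (card crux 2(a)): EquilibriumFastWindowLD ⟹
KineticWindowLDUniform — the window LD for fast one-body functionals transfers from global Gibbs
data (all constant parameters) to smooth local Gibbs data, uniformly over dilute profiles (σ³·sup a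
≤ η₀ ∫a). Intended proof: cells of size δ separated by corridors of width κ, w ≪ κ ≪ δ; influence
travels at particle speed plus ε per collision (O(1) at fixed density), so over w → 0 cells decouple
up to LD-negligible events and corridor mass O(κ/δ); Markov property of the hard-core Gibbs law
given corridor contents + ensemble equivalence (cost e^(o(N)): free in LD, lethal in L²); per cell,
Rényi comparison with the frozen-parameter Gibbs law, O(δ) slow contamination of F; δ → 0 after N →
∞. [deps: EquilibriumFastWindowLD, KineticWindowLDUniform] [difficulty: L] -/
@[route_item "route-AtomisticToContinuum-TwoClocks", crux]
def LocalGibbsTransfer : Prop :=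
  EquilibriumFastWindowLD → KineticWindowLDUniform

/-- item stmt-AtomisticToContinuum-9235 · crux · rank 6 · open · by planner
why it might fail: the deterministic dynamics could focus energy ~N^(2/3) on O(1) particles with entropy-invisible probability (f_s ≤ e^(κN)·Gibbs only excludes Gibbs-cost e^(−κ′N) events; cubic tails have sub-extensive LD cost); no maximum principle for hard-sphere energy cascades is known.
sources: NachtergaeleYau2003, OllaVaradhanYau1993, Spohn1991, Literature.Barriers.AtomisticToContinuum.HighMomentumCutoffBarrierNarrow
[crux] UNIFORM INTEGRABILITY OF THE CUBIC ENERGY CURRENT BEFORE THE FIRST SHOCK (shared typed crux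
stmt-AtomisticToContinuum-3655 of route KineticWindows; the card's "cubic UI" conjunct X_T): for
continuous profiles ∃ σ₀ ∀ σ ∈ (0,σ₀) ∀ classical hs-Euler solutions on [0,T) ∀ flow families, if
the local Gibbs fields converge at t = 0 then ∀ t < T ∀ ε > 0 ∃ M ∃ N₀ ∀ N ≥ N₀ ∀ s ∈ [0,t]:
E[(N+1)⁻¹ Σ_i |v_i(s)|³ 1{|v_i(s)| > M}] ≤ ε. Needed here only for the energy equation (heat flux
and (E+p)u): the quadratic momentum closure needs no tail input in this route (energy conservation +
the o(N) entropy bootstrap exclude sparse energy concentration, whose local-Gibbs cost is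
extensive), but cubic mass on a vanishing fraction of particles has SUB-extensive cost. [difficulty:
open-problem] -/
@[route_item "route-AtomisticToContinuum-TwoClocks", crux]
def EnergyCurrentTails : Prop :=
  ∀ (a₀ θ₀ : Literature.MathematicalPhysics.KineticTheory.T3 → ℝ) (u₀ : Literature.MathematicalPhysics.KineticTheory.T3 → Literature.MathematicalPhysics.KineticTheory.V3), Continuous a₀ → Continuous θ₀ → Continuous u₀ → (∀ x, 0 < a₀ x) → (∀ x, 0 < θ₀ x) → ∃ σ₀ : ℝ, 0 < σ₀ ∧ ∀ σ : ℝ, 0 < σ → σ < σ₀ → ∀ (T : ℝ) (ρ θ : ℝ → Literature.MathematicalPhysics.KineticTheory.T3 → ℝ) (u : ℝ → Literature.MathematicalPhysics.KineticTheory.T3 → Literature.MathematicalPhysics.KineticTheory.V3), Literature.MathematicalPhysics.KineticTheory.IsHardSphereEulerSolution σ T ρ u θ → ∀ Φ : (N : ℕ) → Literature.Analysis.FluidPDE.HardSphereFlow (Literature.Analysis.FluidPDE.Torus.geometry (Fin 3)) (Literature.MathematicalPhysics.KineticTheory.hsDiameter σ N) (N + 1), Literature.MathematicalPhysics.KineticTheory.TendstoHydroFieldsAt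 (fun N => Literature.MathematicalPhysics.KineticTheory.localGibbsLaw σ a₀ u₀ θ₀ N (Φ N)) Φ ρ u θ 0 → ∀ t ∈ Set.Ico 0 T, ∀ ε : ℝ, 0 < ε → ∃ M : ℝ, ∃ N₀ : ℕ, ∀ N : ℕ, N₀ ≤ N → ∀ s ∈ Set.Icc 0 t, ∫⁻ z, ENNReal.ofReal (((N : ℝ) + 1)⁻¹ * ∑ i : Fin (N + 1), Set.indicator {v : Literature.MathematicalPhysics.KineticTheory.V3 | M < ‖v‖} (fun v => ‖v‖ ^ 3) (((Φ N).flow s z i).2)) ∂(Literature.MathematicalPhysics.KineticTheory.localGibbsLaw σ a₀ u₀ θ₀ N (Φ N)) ≤ ENNReal.ofReal ε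

/-- item stmt-AtomisticToContinuum-16624 · crux · rank 7 · open · by planner
why it might fail: no extensive a-priori bound on collision impulses (momentum or energy) under a non-equilibrium hard-sphere law is known (Serre2021/2024 bounds grow in N); the energy impulse is a cubic velocity tail of sub-extensive LD cost; focusing could cage a positive fraction pre-shock.
sources: Serre2021, Serre2024, OllaVaradhanYau1993, BuragoFerlegerKononenko1998, CercignaniIllnerPulvirenti1994
[crux] A-PRIORI L¹ TAILS OF THE WINDOW TRANSFER ACTIVITY UNDER THE TRUE EVOLUTION (rev-10 restate of
CollisionActivityTails stmt-AtomisticToContinuum-13734 with the transfer activity of the repaired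
crux 3; prices its clamp in the clock). For continuous profiles ∃σ₀ ∀σ ∈ (0,σ₀) ∀ classical hs-Euler
solutions on [0,T) tied to the data by the t = 0 LLN, ∀ flows, ∀ t < T ∃V₀ ∀V ≥ V₀ ∀ε > 0 ∃τ₀ ∀τ ≥
τ₀ ∃N₀ ∀N ≥ N₀ ∀s ∈ [0,t]: E_(λ₀)[(N+1)⁻¹ Σ_i a_i(s) 1{a_i(s) > V}] ≤ ε, where a_i(s) := (σ/τ)
Σ_(collisions of i with times in (s, s+w]) (‖v_i⁺ − v_i⁻‖ + |‖v_i⁺‖² − ‖v_i⁻‖²|/2) along the true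
trajectory from the local Gibbs data λ₀ (collisionSum), w = τ(N+1)^(-1/3). Pathwise |w⁻¹(X_true −
X_clamped)| ≤ ‖∇φ‖_∞ Σ_i a_i 1{a_i > V} for the momentum AND the energy row (every dropped record
has a clamped partner; contact ⇒ |φ(x_i)−φ(x_j)| ≤ ‖∇φ‖ε_N; impulse(record) = impulse(twin record)
by momentum and energy conservation — landed
`OneFlightGossipEngineClampedCurrentsDockClampRemainder`), so this is exactly the clock's remainder.
Byte-identical with the landed `Theorems.ClampedCurrentsDockTransferTails.TransferActivityTails` and
implied by the momentum tails stmt-13734 ∧ its energy twin (`stub_ -/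
@[route_item "route-AtomisticToContinuum-TwoClocks", crux]
def TransferActivityTails : Prop :=
  ∀ (a₀ θ₀ : Literature.MathematicalPhysics.KineticTheory.T3 → ℝ) (u₀ : Literature.MathematicalPhysics.KineticTheory.T3 → Literature.MathematicalPhysics.KineticTheory.V3), Continuous a₀ → Continuous θ₀ → Continuous u₀ → (∀ x, 0 < a₀ x) → (∀ x, 0 < θ₀ x) → ∃ σ₀ : ℝ, 0 < σ₀ ∧ ∀ σ : ℝ, 0 < σ → σ < σ₀ → ∀ (T : ℝ) (ρ θ : ℝ → Literature.MathematicalPhysics.KineticTheory.T3 → ℝ) (u : ℝ → Literature.MathematicalPhysics.KineticTheory.T3 → Literature.MathematicalPhysics.KineticTheory.V3), Literature.MathematicalPhysics.KineticTheory.IsHardSphereEulerSolution σ T ρ u θ → ∀ Φ : (N : ℕ) → Literature.Analysis.FluidPDE.HardSphereFlow (Literature.Analysis.FluidPDE.Torus.geometry (Fin 3)) (Literature.MathematicalPhysics.KineticTheory.hsDiameter σ N) (N + 1), Literature.MathematicalPhysics.KineticTheory.TendstoHydroFieldsAt (fun N => Literature.MathematicalPhysics.KineticTheory.localGibbsLaw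 σ a₀ u₀ θ₀ N (Φ N)) Φ ρ u θ 0 → ∀ t ∈ Set.Ico 0 T, ∃ V₀ : ℝ, 0 < V₀ ∧ ∀ V : ℝ, V₀ ≤ V → ∀ ε : ℝ, 0 < ε → ∃ τ₀ : ℝ, 0 < τ₀ ∧ ∀ τ : ℝ, τ₀ ≤ τ → ∃ N₀ : ℕ, ∀ N : ℕ, N₀ ≤ N → ∀ s ∈ Set.Icc 0 t, (let w : ℝ := τ * ((N : ℝ) + 1) ^ (-(1 / 3 : ℝ)); let P := Literature.MathematicalPhysics.KineticTheory.localGibbsLaw σ a₀ u₀ θ₀ N (Φ N); let act := fun (i : Fin (N + 1)) (z : Literature.Analysis.FluidPDE.Config (N + 1) (Fin 3) Literature.MathematicalPhysics.KineticTheory.T3) => σ / τ * (Φ N).collisionSum (Set.Ioc s (s + w)) (fun c => if c.fst = i then ‖c.postVel.1 - c.preVel.1‖ + |‖c.postVel.1‖ ^ 2 - ‖c.preVel.1‖ ^ 2| / 2 else 0) z; ∫⁻ z, ENNReal.ofReal (((N : ℝ) + 1)⁻¹ * ∑ i : Fin (N + 1), Set.indicator {y : ℝ | V < y} (fun y =>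 y) (act i z)) ∂P ≤ ENNReal.ofReal ε)

/-- item stmt-AtomisticToContinuum-3091 · crux · rank 9 · open · by planner
why it might fail: σ-uniform density control at the FIRST singularity of 3-D compressible hs-Euler for ALL smooth data is beyond Sideris1985/LukSpeck2024 (open sets of data); MRRS-type smooth implosions (MerleEtAl2022), if the hs-EOS admits them, push ρ_tσ³ past every η before T* (refuter g48-1 flag).
sources: Sideris1985, LukSpeck2024, MerleEtAl2022, Spohn1991, OllaVaradhanYau1993
[crux] (card crux 1B ∪ 3; the hidden PDE crux of every route) for every η > 0 and all continuous
positive profiles there is σ₀ > 0 such that for 0 < σ < σ₀, every classical hard-sphere-Euler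
solution on [0,T) whose t = 0 fields are the LLN limit of the local Gibbs laws satisfies ρ_t(x)σ³ <
η for all t < T and x — i.e. limsup_{σ→0} σ³ sup_{t<T*_σ} ‖ρ_σ(t)‖_∞ = 0 profile by profile. For
profiles whose ideal-gas development is global or breaks by a non-degenerate shock (Luk–Speck /
Buckmaster–Shkoller–Vicol open sets) this is stability of shock formation under an O(σ³)
equation-of-state and data perturbation; in general it is a σ-uniform density bound at the FIRST
singularity of 3-D compressible Euler for all smooth data. [deps: EosContinuity,
LocalGibbsDensityLimit] [difficulty: open-problem] -/
@[route_item "route-AtomisticToContinuum-TwoClocks", crux]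
def DiluteSelfConsistency : Prop :=
  ∀ η : ℝ, 0 < η → ∀ (a₀ θ₀ : Literature.MathematicalPhysics.KineticTheory.T3 → ℝ) (u₀ : Literature.MathematicalPhysics.KineticTheory.T3 → Literature.MathematicalPhysics.KineticTheory.V3), Continuous a₀ → Continuous θ₀ → Continuous u₀ → (∀ x, 0 < a₀ x) → (∀ x, 0 < θ₀ x) → ∃ σ₀ : ℝ, 0 < σ₀ ∧ ∀ σ : ℝ, 0 < σ → σ < σ₀ → ∀ (T : ℝ) (ρ θ : ℝ → Literature.MathematicalPhysics.KineticTheory.T3 → ℝ) (u : ℝ → Literature.MathematicalPhysics.KineticTheory.T3 → Literature.MathematicalPhysics.KineticTheory.V3), Literature.MathematicalPhysics.KineticTheory.IsHardSphereEulerSolution σ T ρ u θ → ∀ Φ : (N : ℕ) → Literature.Analysis.FluidPDE.HardSphereFlow (Literature.Analysis.FluidPDE.Torus.geometry (Fin 3)) (Literature.MathematicalPhysics.KineticTheory.hsDiameter σ N) (N + 1), Literature.MathematicalPhysics.KineticTheory.TendstoHydroFieldsAt (fun N => Literature.MathematicalPhysics.KineticTheory.localGibbsLaw σ a₀ u₀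 θ₀ N (Φ N)) Φ ρ u θ 0 → ∀ t ∈ Set.Ico 0 T, ∀ x, ρ t x * σ ^ 3 < η

/-- item stmt-AtomisticToContinuum-16625 · crux · rank 11 · open · by planner
why it might fail: black-box POINTWISE thresholds (β₀, τ₀ per reference instance) of KineticWindowLDUniform / C′ do not net uniformly along the Euler reference family (14680/9133 UNIFORMITY finding); localising C′ to local Gibbs families at LD scale is unproved; the energy row wants a ∀β bounded kinetic node.
sources: Yau1991, OllaVaradhanYau1993, KipnisLandim1999, Varadhan1993EntropyMethods, Spohn1991
[crux] THE MACROSCOPIC CLOCK, RUN TO THE STATEMENT (rev-10 restate of ClampedEntropyClock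
stmt-AtomisticToContinuum-15145, whose second antecedent was the refuted stmt-13733 and which was
therefore closed VACUOUSLY by `clampedEntropyClock_proof` — ledger progress only; ranked last: it
renders after every decl it composes): Yau's relative-entropy Gronwall for DETERMINISTIC hard
spheres at fixed small σ³, fed only by finite-window large-deviation inputs — the docking node
KineticWindowLDUniform (fast one-body functionals under local Gibbs data, η₀-uniform), the
transfer-clamped EOS-projected collisional window LD ClampedTransferWindowLD (crux 3, global
equilibrium), the two a-priori tail inputs under the true law (TransferActivityTails prices the
clamp, EnergyCurrentTails truncates the heat flux) and dilute self-consistency of the Euler solution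
— implies the sub-problem Statement. The statics UniformLocalGibbsConcentration, HsEosLowDensity and
the entropy inequality EntropyToHydro (via RelEntropyVanishing) are PROVED supports and are lemmas
inside its proof. Proof shape (Yau1991, OllaVaradhanYau1993 §3, KipnisLandim1999 Ch. 6): (i)
Liouville-invariant entropy identity w.r.t. the loc -/
@[route_item "route-AtomisticToContinuum-TwoClocks", crux]
def TransferEntropyClock : Prop :=
  KineticWindowLDUniform → ClampedTransferWindowLD → TransferActivityTails → EnergyCurrentTails → DiluteSelfConsistency → _root_.HydrodynamicLimit

/-- item stmt-AtomisticToContinuum-0768 · support · rank 9 · closed · proved by Summit.AtomisticToContinuum.HydrodynamicLimit.Theorems.hsEosLowDensity_proof (prover) · by planner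
sources: Ruelle1969, LebowitzPenrose1964
[support] Hard-sphere equation of state at low density: ∃ η₀ > 0 and F real-analytic on (−η₀, η₀)
with hsExcessFreeEnergy = F on [0, η₀), F(0) = 0, F'(0) = 2π/3 (second virial coefficient of
unit-diameter spheres), and the canonical thermodynamic limit −N⁻¹ log hsFreeVolume η N → F(η)
exists (not just limsup) for η ∈ [0, η₀). Ruelle1969 §3.4 (existence), LebowitzPenrose1964
(convergence of the virial expansion ⇒ analyticity). Makes hsCompressibility/hsPressure smooth and
Z(η) = 1 + (2π/3)η + O(η²); needed by every route (hyperbolicity of the Euler system, virial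
theorem). -/
@[route_item "route-AtomisticToContinuum-TwoClocks"]
def HsEosLowDensity : Prop :=
  ∃ η₀ : ℝ, 0 < η₀ ∧ ∃ F : ℝ → ℝ, AnalyticOnNhd ℝ F (Set.Ioo (-η₀) η₀) ∧ Set.EqOn Literature.MathematicalPhysics.KineticTheory.hsExcessFreeEnergy F (Set.Ico 0 η₀) ∧ F 0 = 0 ∧ deriv F 0 = 2 * Real.pi / 3 ∧ ∀ η ∈ Set.Ico 0 η₀, Filter.Tendsto (fun N : ℕ => -(N : ℝ)⁻¹ * Real.log (Literature.MathematicalPhysics.KineticTheory.hsFreeVolume η N)) Filter.atTop (nhds (F η))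

/-- `HsEosLowDensity` holds: proved by `Summit.AtomisticToContinuum.HydrodynamicLimit.Theorems.hsEosLowDensity_proof`. -/
theorem HsEosLowDensity_holds : HsEosLowDensity := _root_.Summit.AtomisticToContinuum.HydrodynamicLimit.Theorems.hsEosLowDensity_proof

/-- item stmt-AtomisticToContinuum-0769 · support · rank 9 · closed · proved by Summit.AtomisticToContinuum.HydrodynamicLimit.Theorems.heatBathForgetting_assembly_proof @ 7068fd10e358 (prover) · by planner
sources: Yau1991, OllaVaradhanYau1993, KipnisLandim1999
[assembly] X_RE → HydrodynamicLimit: entropy inequality μ(A) ≤ (log 2 + H(μ|λ))/log(1 + 1/λ(A))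
(from Donsker–Varadhan / Mathlib klDiv API) with λ(A) ≤ C e^{-(N+1)/C} and H = o(N) gives μ(A) → 0;
μ = lawAt (Φ N) P t = P.map (flow t) turns μ{z | δ < |field z − ·|} into P{z | δ < |field (flow t z)
− ·|} (measurable_flow); the reference concentration is stated for z itself and TendstoHydroFieldsAt
at time 0 of the reference law is not needed. Zero-mass case impossible by the IsProbabilityMeasure
clauses; take σ₀ from X_RE. -/
@[route_item "route-AtomisticToContinuum-TwoClocks"]
def EntropyToHydro : Prop :=
  RelEntropyVanishing → Literature.MathematicalPhysics.KineticTheory.HydrodynamicLimit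

/-- item stmt-AtomisticToContinuum-14445 · support · rank 9 · closed · proved by Summit.AtomisticToContinuum.HydrodynamicLimit.Theorems.uniformLocalGibbsConcentration_proof (prover) · by planner
sources: Ruelle1969, LebowitzPenrose1964, KipnisLandim1999
[support] η₀-UNIFORM EXPONENTIAL LLN FOR CANONICAL LOCAL GIBBS STATES (the consumable strengthening
of stmt-0767, whose σ₀ is profile-wise): ∃ η₀ > 0 ∀ continuous a, θ₀ > 0, u₀ ∀ σ > 0 with σ³·sup a ≤
η₀ ∫a: the laws localGibbsLaw σ a u₀ θ₀ N Φ are probability measures for all N, Φ, and there is a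
continuous density profile ρ₀ > 0 such that the empirical density/momentum/energy fields tested
against any continuous χ concentrate exponentially (≤ C e^(−(N+1)/C)) around ∫χρ₀, ∫χρ₀u₀,
∫χE(ρ₀,u₀,θ₀). Static: low-density cluster expansion. [difficulty: M] -/
@[route_item "route-AtomisticToContinuum-TwoClocks", crux]
def UniformLocalGibbsConcentration : Prop :=
  ∃ η₀ : ℝ, 0 < η₀ ∧ ∀ (a θ₀ : Literature.MathematicalPhysics.KineticTheory.T3 → ℝ) (u₀ : Literature.MathematicalPhysics.KineticTheory.T3 → Literature.MathematicalPhysics.KineticTheory.V3), Continuous a → Continuous θ₀ → Continuous u₀ → (∀ x, 0 < a x) → (∀ x, 0 < θ₀ x) → ∀ σ : ℝ, 0 < σ → σ ^ 3 * (⨆ x, a x) ≤ η₀ * ∫ x, a x → ∃ ρ₀ : Literature.MathematicalPhysics.KineticTheory.T3 → ℝ, Continuous ρ₀ ∧ (∀ x, 0 < ρ₀ x) ∧ (∀ (N : ℕ) (Φ : Literature.Analysis.FluidPDE.HardSphereFlow (Literature.Analysis.FluidPDE.Torus.geometry (Fin 3)) (Literature.MathematicalPhysics.KineticTheory.hsDiameter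 σ N) (N + 1)), MeasureTheory.IsProbabilityMeasure (Literature.MathematicalPhysics.KineticTheory.localGibbsLaw σ a u₀ θ₀ N Φ)) ∧ ∀ χ : Literature.MathematicalPhysics.KineticTheory.T3 → ℝ, Continuous χ → ∀ δ : ℝ, 0 < δ → ∃ C : ℝ, 0 < C ∧ ∀ (N : ℕ) (Φ : Literature.Analysis.FluidPDE.HardSphereFlow (Literature.Analysis.FluidPDE.Torus.geometry (Fin 3)) (Literature.MathematicalPhysics.KineticTheory.hsDiameter σ N) (N + 1)), Literature.MathematicalPhysics.KineticTheory.localGibbsLaw σ a u₀ θ₀ N Φ {z | δ < |Literature.MathematicalPhysics.KineticTheory.empiricalDensityField z χ - ∫ x, χ x * ρ₀ x|} ≤ ENNReal.ofReal (C * Real.exp (-(C⁻¹ * (N + 1)))) ∧ Literature.MathematicalPhysics.KineticTheory.localGibbsLaw σ a u₀ θ₀ N Φ {z | δ < ‖Literature.MathematicalPhysics.KineticTheory.empiricalMomentumField z χ - ∫ x, (χ x * ρ₀ x) • u₀ x‖} ≤ ENNReal.ofReal (C * Real.exp (-(C⁻¹ * (N + 1)))) ∧ Literature.MathematicalPhysics.KineticTheory.localGibbsLaw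 σ a u₀ θ₀ N Φ {z | δ < |Literature.MathematicalPhysics.KineticTheory.empiricalEnergyField z χ - ∫ x, χ x * Literature.MathematicalPhysics.KineticTheory.totalEnergyDensity (ρ₀ x) (u₀ x) (θ₀ x)|} ≤ ENNReal.ofReal (C * Real.exp (-(C⁻¹ * (N + 1))))

/-- item stmt-AtomisticToContinuum-14446 · support · rank 9 · open · by planner
sources: BGSSCPAM2023, BodineauEtAl2024, LeBihan2022, BodineauGallagherSaintRaymondInvent2016
[support] THE CHEAPEST TYPED RUNG (stake out first; ex-stmt-3656 with the universal σ₀): crux 2 for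
u₀ = 0 and the kinetic shear stress F(x,v) = φ(x)v¹v² (continuous φ; automatically orthogonal to 1,
v, |v|² under the centred Maxwellian). Λ_(2τ) ≤ Λ_τ by Hölder + invariance; only Boltzmann–Grad →
fixed small σ³ over a finite window is new. Its negation closes the route. [difficulty:
open-problem] -/
@[route_item "route-AtomisticToContinuum-TwoClocks"]
def EquilibriumShearWindowLD : Prop :=
  ∃ σ₀ : ℝ, 0 < σ₀ ∧ ∀ (a₀ θ₀ : ℝ), 0 < a₀ → 0 < θ₀ → ∀ σ : ℝ, 0 < σ → σ < σ₀ → ∀ Φ : (N : ℕ) → Literature.Analysis.FluidPDE.HardSphereFlow (Literature.Analysis.FluidPDE.Torus.geometry (Fin 3)) (Literature.MathematicalPhysics.KineticTheory.hsDiameter σ N) (N + 1), ∀ φ : Literature.MathematicalPhysics.KineticTheory.T3 → ℝ, Continuous φ → ∃ β₀ : ℝ, 0 < β₀ ∧ ∀ β : ℝ, |β| ≤ β₀ → ∀ ε : ℝ, 0 < ε → ∃ τ : ℝ, 0 < τ ∧ ∃ N₀ : ℕ, ∀ N : ℕ, N₀ ≤ N → ∫⁻ z, ENNReal.ofReal (Real.exp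 (β * ∑ i : Fin (N + 1), (τ * ((N : ℝ) + 1) ^ (-(1 / 3 : ℝ)))⁻¹ * ∫ r in (0 : ℝ)..(τ * ((N : ℝ) + 1) ^ (-(1 / 3 : ℝ))), φ ((Φ N).flow r z i).1 * (((Φ N).flow r z i).2 0 * ((Φ N).flow r z i).2 1))) ∂(Literature.MathematicalPhysics.KineticTheory.localGibbsLaw σ (fun _ => a₀) (fun _ => 0) (fun _ => θ₀) N (Φ N)) ≤ ENNReal.ofReal (Real.exp (ε * ((N : ℝ) + 1)))

-- earlier Assembly (stmt-AtomisticToContinuum-13736, replaced 2026-08-15T21:18:55Z -> stmt-AtomisticToContinuum-13805): retired by None — KineticWindowLDUniform → EquilibriumClampedCollisionalWindowLD → EnergyCurrentTails → CollisionActivityTails → UniformLocalGibbsConcentration → HsEosLowDensity → DiluteSelfConsistency → ClampedWindowDock → EntropyToHydro → _root_.HydrodynamicLimit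
-- earlier Assembly (stmt-AtomisticToContinuum-13805, replaced 2026-08-16T20:17:18Z -> stmt-AtomisticToContinuum-16626): proved by Summit.AtomisticToContinuum.HydrodynamicLimit.Theorems.twoClocksAssembly_proof @ 055f6da789e5 — KineticWindowLDUniform → EquilibriumClampedCollisionalWindowLD → EnergyCurrentTails → CollisionActivityTails → UniformLocalGibbsConcentration → HsEosLowDensity → DiluteSelfCons
-- earlier Assembly (stmt-AtomisticToContinuum-14448, replaced 2026-08-15T20:20:39Z -> stmt-AtomisticToContinuum-13736): retired by None — KineticWindowLDUniform → EquilibriumCollisionalWindowLD → EnergyCurrentTails → CollisionTransferTails → UniformLocalGibbsConcentration → HsEosLowDensity → DiluteSelfConsistency → WindowDock → EntropyToHydro → _root_.HydrodynamicLimit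
/-- item stmt-AtomisticToContinuum-16626 · assembly · rank 1 · open · by planner
sources: Yau1991, OllaVaradhanYau1993, KipnisLandim1999
[assembly] KineticWindowLDUniform → ClampedTransferWindowLD → EnergyCurrentTails →
TransferActivityTails → UniformLocalGibbsConcentration → HsEosLowDensity → DiluteSelfConsistency →
HydrodynamicLimit (rev 10: the rev-4 frame restated over the repaired collisional pair; the old
frame stmt-13805 had the refuted stmt-13733 as an antecedent and is vacuous). The frame statement
"X_TC ∧ statics → Statement": the analytic inputs consumed by `closes` (kinetic docking node,
transfer-clamped collisional window LD, the two a-priori tail inputs, uniform local-Gibbs LLN,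
low-density EOS, dilute self-consistency) imply the sub-problem Statement. A WEAKENING of crux 11
TransferEntropyClock (`fun hK h₃ h₆ h₇ _ _ hS => hC hK h₃ h₇ h₆ hS`, Sketch.lean rc 0), closing by
one line the moment that crux closes; `closes` does not take Assembly as a hypothesis; not
battery-provable (its antecedents are open). -/
@[route_item "route-AtomisticToContinuum-TwoClocks", crux]
def Assembly : Prop :=
  KineticWindowLDUniform → ClampedTransferWindowLD → EnergyCurrentTails → TransferActivityTails → UniformLocalGibbsConcentration → HsEosLowDensity → DiluteSelfConsistency → _root_.HydrodynamicLimit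

-- records of items no longer active in this route (dropped / restated):
-- earlier EquilibriumClampedCollisionalWindowLD (stmt-AtomisticToContinuum-13733, replaced 2026-08-16T20:17:18Z -> stmt-AtomisticToContinuum-16623): refuted by Summit.AtomisticToContinuum.HydrodynamicLimit.Theorems.OneFlightGossipEngineEquilibriumClampedCollisionalWindowLD_refuted @ 8061795fe1a3 — ∃ σ₀ : ℝ, 0 < σ₀ ∧ ∀ (a₀ θ₀ : ℝ) (u₀ : Literature.MathematicalPhysics.KineticTheory.V3), 0 < a₀ → 0 < θ
-- earlier CollisionActivityTails (stmt-AtomisticToContinuum-13734, replaced 2026-08-16T20:17:18Z -> stmt-AtomisticToContinuum-16624): moot by None — ∀ (a₀ θ₀ : Literature.MathematicalPhysics.KineticTheory.T3 → ℝ) (u₀ : Literature.MathematicalPhysics.KineticTheory.T3 → Literature.MathematicalPhysics.KineticTheory.V3), Continuous a₀ → Continuous θ₀ → Continuous u₀ → (∀ x, 0 < a₀ x) → (∀ x, 0 < θ₀ x) →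
-- earlier ClampedWindowDock (stmt-AtomisticToContinuum-13735, dropped 2026-08-16T20:17:18Z): proved by Summit.AtomisticToContinuum.HydrodynamicLimit.Theorems.clampedWindowDock_proof @ 4d363ff6c63c — KineticWindowLDUniform → EquilibriumClampedCollisionalWindowLD → CollisionActivityTails → EnergyCurrentTails → UniformLocalGibbsConcentration → HsEosLowDensity → DiluteSelfConsistency → RelEntropyVanishi
-- earlier EquilibriumCollisionalWindowLD (stmt-AtomisticToContinuum-14441, replaced 2026-08-15T20:20:39Z -> stmt-AtomisticToContinuum-13733): retired by None — ∃ σ₀ : ℝ, 0 < σ₀ ∧ ∀ (a₀ θ₀ : ℝ) (u₀ : Literature.MathematicalPhysics.KineticTheory.V3), 0 < a₀ → 0 < θ₀ → ∀ σ : ℝ, 0 < σ → σ < σ₀ → ∀ Φ : (N : ℕ) → Literature.Analysis.FluidPDE.HardSphereFlow (Literature.Analysis.FluidPDE.Torus.geometry (Fin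
-- earlier CollisionTransferTails (stmt-AtomisticToContinuum-14444, replaced 2026-08-15T20:20:39Z -> stmt-AtomisticToContinuum-13734): retired by None — ∀ (a₀ θ₀ : Literature.MathematicalPhysics.KineticTheory.T3 → ℝ) (u₀ : Literature.MathematicalPhysics.KineticTheory.T3 → Literature.MathematicalPhysics.KineticTheory.V3), Continuous a₀ → Continuous θ₀ → Continuous u₀ → (∀ x, 0 < a₀ x) → (∀ x, 0 < θ₀ x
-- earlier WindowDock (stmt-AtomisticToContinuum-14447, replaced 2026-08-15T20:20:39Z -> stmt-AtomisticToContinuum-13735): retired by None — KineticWindowLDUniform → EquilibriumCollisionalWindowLD → CollisionTransferTails → EnergyCurrentTails → UniformLocalGibbsConcentration → HsEosLowDensity → DiluteSelfConsistency → RelEntropyVanishing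
-- earlier ClampedEntropyClock (stmt-AtomisticToContinuum-15145, replaced 2026-08-16T20:17:18Z -> stmt-AtomisticToContinuum-16625): proved by Summit.AtomisticToContinuum.HydrodynamicLimit.Theorems.clampedEntropyClock_proof @ 4d363ff6c63c — KineticWindowLDUniform → EquilibriumClampedCollisionalWindowLD → CollisionActivityTails → EnergyCurrentTails → DiluteSelfConsistency → _root_.HydrodynamicLimit

/-! D-0027 §2.1 — DECIDING THEOREM (planner-authored via `route open/edit --closes-file`; by planner-rfix-AtomisticToContinuum-TwoClocks-14734c96-0 2026-08-16T20:17:18Z):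
its hypotheses are this route's items and its conclusion the sub-problem Statement (glue_lint), and it elaborates with this file. -/

/-- D-0027 §2.1 deciding theorem of route TwoClocks (pure logic; crux-only since rev 6; re-docked in rev 10 after the
Lean refutation of ex-crux 3 stmt-13733 `EquilibriumClampedCollisionalWindowLD` — Newton-cradle energy relay against the
momentum-only activity clamp, class refuted-misstated): its seven binders are exactly the route's seven cruxes and
nothing else. The two kinetic cruxes — the global-equilibrium window LD `EquilibriumFastWindowLD` (crux 2) and the
transfer `LocalGibbsTransfer` (crux 5, literally `EquilibriumFastWindowLD → KineticWindowLDUniform`) — produce the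
docking node `KineticWindowLDUniform` (the intermediate target, typed, claimable) INSIDE the proof (`h₅ h₂`); the
macroscopic clock `TransferEntropyClock` (crux 11: Yau's relative-entropy Gronwall fed by the window-LD inputs, with the
PROVED statics `UniformLocalGibbsConcentration` / `HsEosLowDensity` and the PROVED entropy inequality `EntropyToHydro`
as lemmas inside ITS proof) turns that node, the repaired TRANSFER-CLAMPED collisional crux `ClampedTransferWindowLD`
(crux 3 = C′), the two a-priori tail inputs `TransferActivityTails` (crux 7) and `EnergyCurrentTails` (crux 6) and the
PDE-side crux `DiluteSelfConsistency` (crux 9) into the sub-problem Statement. No support, target or assembly item is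
a hypothesis; every crux is a binder. If `KineticWindowLDUniform` is ever proved directly, tenure re-promotes it,
re-docks `closes` on it and drops cruxes 2 and 5 (KILL CRITERIA). -/
@[closes "route-AtomisticToContinuum-TwoClocks"] theorem closes (h₂ : EquilibriumFastWindowLD) (h₅ : LocalGibbsTransfer)
    (h₃ : ClampedTransferWindowLD) (h₆ : EnergyCurrentTails) (h₇ : TransferActivityTails)
    (hS : DiluteSelfConsistency) (hC : TransferEntropyClock) :
    _root_.HydrodynamicLimit :=
  hC (h₅ h₂) h₃ h₇ h₆ hS

end Summit.AtomisticToContinuum.HydrodynamicLimit.Theses.TwoClocks
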